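import Mathlib
import Literature.MathematicalPhysics.QuantumFieldTheory.Balaban1983to89.B5AverageCurlStokes

/-!
# T4AveragingDeficit — the ONE-STEP ABELIAN ACTION DEFICIT of Bałaban's linear block average `Q_k` (B5 (1.18)): the exact pair-variance identity behind Federbush's «averaging decreases the action», its polarisation, and a stencil Poincaré inequality — (β′)/(β) of the energy-convexity route to NE3 AT MODEL LEVEL, for the tree's TYPED operator (cell `pub-balaban`, T4-DAG node U1 (b), spine estimate NE3, row T4-U1b.NE3-PROVE-P2d*; [folklore] finite algebra on the typed torus; sibling of `T4ConvexResponse`/`T4ConstrainedAgmon(D)`, built on `B5AverageCurlStokes`)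

HONEST FRAMING (cell `pub-balaban`, T4-DAG PAGE 1).  The cell's T4 target is the existence AND uniqueness of the
continuum limit of Bałaban's unit-scale averaged loop expectations on a FINITE torus T⁴ — strictly beyond ultraviolet
stability; there is NO mass gap statement here, it is NOT the Clay problem and NOT summit progress.  This module is kernel
work of ONE technique seat (energy-convexity, P2) for the cell's NEW ESTIMATE NE3 = «η-rate of the minimisers» (node U1 (b);
NE3 is by the cell's DAG §3 free of the conditionals BetaPertH, (B), (B^μ), and nothing below mentions them).  Its subject is
the route's FIRST NON-FOLLOWING STEP, the derivative-defect bound β (cell register GAPS G-ne3p2-1; record HOME/t4/T4-EST-NE3-P2.md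
§7 and its Appendix β, HOME/t4/T4-EST-NE3-P2-beta.md v0.5): for the defect functional `𝓓 = A^{ξ_c} ∘ avg − A^{ξ_f}` (the Wilson
action after one block-averaging step minus before) one needs `|D𝓓(U)[ψ]| ≤ C ξ ‖∇_U F‖ ‖d_Uψ‖` — a RATE of one lattice spacing
carried by one covariant difference of the curvature.  What is kernel-checked HERE is the LEADING (abelian, straight-stencil)
TERM of that bound, for the tree's TYPED linear average `B5Block118.QvOp` on complex vector fields over the typed torus of
`B5Prop11Plancherel`, in every dimension `d`, for every block side `n ≥ 1` and every coarse torus `Π_μ ℤ/M_μ`: the one-step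
deficit in Federbush's Abelian Stability Theorem (tree: `B5AverageCurlStokes.sum_normSq_plaq_QvOp_le`, constant exactly 1) is
computed EXACTLY, and its value and its derivative are bounded by one fine-lattice difference of the plaquette field, with
explicit constants and no volume factor.  NOTHING is asserted about Bałaban's non-linear average (B7 (15)), his minimisers,
operators or norms: the non-abelian dressings, the correction exponentials and the Bianchi remainder of Appendix β §3–§4 are
[analysis] in the record and are NOT here.  Value = kernel certificate of the mechanism «deficit = stencil pair-variance ⇒
rate = one difference» on the actual typed operator (the record's Appendix β §5 (L7)–(L8) and §6, abelian skeleton, with the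
constants `6(d+2)n⁴` and `√(6(d+2)n⁴)·n`); NOT summit progress.

CITATION HEADER (lean-in-tree rule 2026-08-18).  PUBLISHED sources whose statements are REPRODUCED for the typed operator (never
used as hypotheses — every statement below is a kernel theorem about the tree's definitions):
* P. Federbush, *A phase cell approach to Yang–Mills theory. I. Modes, lattice-continuum duality*, Commun. Math. Phys. **107**
  (1986) 319–329 [Federbush1986PhaseCellI] (published, outside the series under audit), p. 321 'Abelian Stability Theorem'
  (0.12) «averaging decreases the action»; p. 322 (1.3)–(1.4) plaquette averaging = closed-loop averaging.  In the tree: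
  `B5AverageCurlStokes.sum_normSq_plaq_QvOp_le` (`n^d Σ_y ‖plaq(Q_kA)‖² ≤ n² Σ_x ‖plaq A‖²`).  THIS FILE computes the deficit
  of that inequality exactly (`deficit_eq`) — Federbush states the inequality, not the identity; the identity is [folklore]
  (the variance decomposition of a mean of `N` numbers).
* T. Bałaban, J. Imbrie, A. Jaffe, *Renormalization of the Higgs model: minimizers, propagators and the stability of mean field
  theory*, Commun. Math. Phys. **97** (1985) 299–329 [BalabanImbrieJaffe1985] (published, outside the series), (2.13) p. 304 and
  p. 309 («Q_k = (Q)^k … given by the formula (2.13), where L is replaced by L^k») — the block average whose typed form is `QvOp`.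
Sources of the series under audit, quoted for DEFINITIONS ONLY (all already typed in the tree; no sentence is used as a fact):
* T. Bałaban, *Propagators and renormalization transformations for lattice gauge theories. I*, Commun. Math. Phys. **95** (1984)
  17–40 [Balaban1984PropagatorsI] («B5»): (1.1)/(1.2) p. 18 the vector field and `F_{μν}` = `B5Action121.Fs` (`= c · plaq`,
  `B5AverageCurlStokes.Fs_eq_mul_plaq`); (1.4) p. 18 the gauge transformation `A^λ` = `B5Action121.gaugeT` with `Fs_gaugeT`;
  (1.6) p. 18 the blocks `B^k(y)` = `B5Block118.bpt`, partition `B5Blocks16.bpt_bijective`; (1.18) p. 20 the average `Q_k` =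
  `B5Block118.QvOp`; (1.20)–(1.21) pp. 20–21 `Q_kA^λ = Q_kA − ∂Q′_kλ` = `B5Block118.QvOp_gaugeT_eq` and the action.
* T. Bałaban, *Averaging operations for lattice gauge theories*, Commun. Math. Phys. **98** (1985) 17–51 [Balaban1985Averaging]
  («B7» of the tree's module names): (14)–(15) p. 19 the linear and the non-linear average, (48) p. 25 the linearisation — NAMED
  FOR ORIENTATION ONLY (the object whose abelian/linear layer `QvOp` is; nothing of this paper is used).
* T. Bałaban, *The variational problem and background fields in renormalization group method for lattice gauge theories*, Commun.
  Math. Phys. **102** (1985) 277–309 [Balaban1985Variational] («B11»): (115) p. 294, (116)–(121), Proposition 6 p. 295 — CONTEXT ONLY for what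
  the cell's NE3 and its defect functional `𝓓` are about (record §1); nothing of B11 is used.
[cite: Federbush1986PhaseCellI, (0.12) p. 321, (1.3)–(1.4) p. 322; BalabanImbrieJaffe1985, (2.13) p. 304, p. 309;
Balaban1984PropagatorsI, (1.2), (1.4), (1.6) p. 18, (1.18), (1.20) p. 20, (1.21) p. 21 (definitions); Balaban1985Averaging (14)–(15)
p. 19, (48) p. 25 and Balaban1985Variational (115) p. 294, (116)–(121) p. 295 (orientation/context only)]

WHAT IS PROVED (all [folklore], sorry-free; `θ := plaq (fine n M) A μ ν` is the fine plaquette variable in the `(μ, ν)` plane,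
`X_y(P) = n·y + j + s e_μ + t e_ν`, `P = (j, s, t) ∈ {0,…,n−1}^d × {0,…,n−1}²`, the `n^{d+2}` fine plaquettes of the STENCIL of the
coarse plaquette at `y` — `plaq_QvOp_spt`: `plaq(Q_kA)(y) = n^{-(d+1)} Σ_P θ(X_y(P))`, which is `B5AverageCurlStokes.plaq_QvOp`).
§1 The real pairing `rin a b = Re(conj a · b)` and the PAIR-VARIANCE ALGEBRA of a finite complex family: `normSq_sum_eq`
  (`‖Σ a‖² = N Σ‖aᵢ‖² − ½ ΣᵢΣⱼ ‖aⱼ − aᵢ‖²`), `rin_sum_sum_sub` + `sum_sum_rin_sub_eq` (its polar form as an antisymmetrised pair sum),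
  `abs_rin_sum_sum_sub_le` (Cauchy–Schwarz for the pair form: `|Re(conj(Σa)(Σb)) − N Σ Re(conj aᵢbᵢ)| ≤ ½ √pvar(a) √pvar(b)`).
§2 The stencil: `Off`, `card_Off` (`= n^{d+2}`), `spt`, `sum_squareSum_eq`, `plaq_QvOp_spt`, the COUNTING IDENTITY `sum_sum_spt`
  (`Σ_y Σ_P g(X_y(P)) = n² Σ_x g(x)`: every fine plaquette lies in exactly `n²` stencils), `sum_sum_bpt_add`; the stencil pair-variance
  `W(θ) = Σ_y Σ_P Σ_{P′} ‖θ(X_yP′) − θ(X_yP)‖²`; the normalised deficit `deficit A μ ν = n^d Σ_y ‖plaq(Q_kA)‖² − n² Σ_x ‖plaq A‖²`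
  (`deficit_nonpos` = Federbush's theorem, tree); and THE EXACT DEFICIT IDENTITY `deficit_eq`:
  `n^d Σ_y ‖plaq(Q_kA)‖² − n² Σ_x ‖plaq A‖² = −½ n^{-(d+2)} W(plaq A)`.
§3 Polarisation (no calculus, no junk values): `bil` (the polar form), `plaq_add_smul`, `QvOp_add_smul`, `deficit_add_smul`
  (`deficit(A + sψ) = deficit A + 2s·B(A,ψ) + s²·deficit ψ`, all real `s`), `bil_eq` (pair form), `abs_bil_le_sqrt_W`, `W_plaq_eq`
  (`W(plaq A) = 2n^{d+2}|deficit A|`), `abs_bil_le` (`|B(A,ψ)| ≤ √|deficit A| √|deficit ψ|` — THE DERIVATIVE IS CONTROLLED BY THE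
  VALUES, by semidefiniteness), `sq_bil_le`, `abs_deficit_le_fine` (`|deficit ψ| ≤ n² Σ‖plaq ψ‖²`), `abs_bil_le_energy`
  (`|B(A,ψ)| ≤ √|deficit A| · n (Σ_x‖plaq ψ‖²)^{1/2}`).
§4 THE STENCIL POINCARÉ INEQUALITY `W_le`: `W(θ) ≤ 12 n^{d+6} (E_μ(θ) + E_ν(θ) + d Σ_κ E_κ(θ))`, `E_κ(θ) = Σ_x ‖θ(x+e_κ) − θ(x)‖²`
  (`fd`, `dE`), WITHOUT VOLUME LOSS — by a three-leg path between any two stencil points (`ν`-offset, `μ`-offset, then the block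
  digits one direction at a time: `mrg`, `ins`, `mrg_succ`, `bpt_update`, `normSq_sub_tstep_le`, `normSq_sub_sub_le`,
  `normSq_sub_le_three`, `normSq_sub_digits_le`, `stencil_pointwise`) and EXACT PATH COUNTING (`sum_stencil_reindex`,
  `sum_sum_sum_bpt_add`, and the fibre count `sum_ins`: `Σ_b Σ_a Σ_i G(ins κ i a b) = n^{d+1} Σ_w G(w)` by an explicit bijection;
  `sum_T1f`, `sum_T2f`, `sum_T3f`); `W_le'` (`≤ 12(d+2) n^{d+6} Σ_κ E_κ`).
§5 THE MODEL FORM OF (β′) AND (β): `abs_deficit_le` (`|deficit A| ≤ 6n⁴(E_μ + E_ν + dΣ_κE_κ)(plaq A)`), `abs_deficit_le'`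
  (`≤ 6(d+2)n⁴ Σ_κ E_κ(plaq A)`), `abs_bil_le_dE` (`|B(A,ψ)| ≤ (6(d+2)n⁴ Σ_κE_κ(plaq A))^{1/2} · n (Σ_x‖plaq ψ‖²)^{1/2}`), `beta_model`
  (both), and GAUGE INVARIANCE `plaq_gaugeT`, `plaq_QvOp_gaugeT`, `deficit_gaugeT`, `bil_gaugeT` (B5 (1.4), (1.20)–(1.21), from the
  tree's `Fs_gaugeT`, `QvOp_gaugeT_eq`): only the plaquette field of a perturbation enters.
§6 [v1.1] LOCALITY OF (β): `pvarAt` (`V_y`, stencil pair variance at one coarse plaquette; `W = Σ_y V_y`), the stencil density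
  `bilAt` (`B = n^{-(d+2)} Σ_y b_y`, `bil_eq_sum_bilAt`), Cauchy–Schwarz PER STENCIL `abs_bilAt_le` (`|b_y| ≤ ½ V_y(θ_A)^{1/2} V_y(θ_ψ)^{1/2}`),
  `bilAt_eq_zero_of_pvarAt_eq_zero`, `abs_bil_le_local` (for any coarse region `Y` off which `plaq ψ` is stencil-constant:
  `|B(A,ψ)| ≤ ½ n^{-(d+2)} (Σ_{y∈Y} V_y(plaq A))^{1/2} W(plaq ψ)^{1/2}`), the LOCAL three-leg energy `Eloc` (`E^{loc}_y`) with
  `pvarAt_le_Eloc` (local stencil Poincaré), `sum_Eloc_eq` (`Σ_y E^{loc}_y = 12 n^{d+6}(E_μ + E_ν + dΣ_κE_κ)` exactly), `sum_Eloc_le`,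
  and `abs_bil_le_local_energy` (`|B(A,ψ)| ≤ ½ n^{-(d+2)} (Σ_{y∈Y} E^{loc}_y(plaq A))^{1/2} (2n^{d+4} Σ_x‖plaq ψ‖²)^{1/2}`): the
  derivative sees the difference energy of `plaq A` ONLY on the three-leg regions of the blocks where `ψ` acts — the finite-range
  form of (β) that the localisation step δ consumes (record §5.3) — and `Y = everything` recovers §5.

DICTIONARY TO THE RECORD [analysis/bookkeeping, not kernel; record Appendix β v0.5 §5–§6 and §3.6].  (i) UNITS.  With fine spacing
`ξ_f`, coarse spacing `ξ_c = n ξ_f`, fine plaquette ANGLES `ϑ = ξ_f² F` (so B5's `plaq A = n ϑ`, `plaq(Q_kA) = ϑ̄ = n^{-d} Σ_P ϑ(X_yP)`,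
the block mean of the square fluxes) and the quadratic Wilson actions `S^ξ = ½ ξ^{d−4} Σ_p ϑ_p²`, the per-plane action defect is
`S^{ξ_c}(Q_kA) − S^{ξ_f}(A) = ½ ξ_c^{d−4} n^{-d} · deficit`, and `Σ_κ E_κ(plaq A) = n² ξ_f^{6−d} ‖∇^{ξ_f}F‖²_{L²}`; hence `abs_deficit_le'`
READS `|S^{ξ_c}(Q_kA) − S^{ξ_f}(A)|_{plane} ≤ 3(d+2) · ξ_c² · ‖∇^{ξ_f}F_{μν}‖²_{L²}` — rate (coarse spacing)², the record's (β′)_lin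
(`stencil_energyDefect_le` of `T4ConvexResponse` is the abstract-stencil version; here the stencil is the actual one of `QvOp` and the
path counting is done on the torus) — and `abs_bil_le` READS `|D(S^{ξ_c}∘Q_k − S^{ξ_f})(A)[ψ]|_{plane} ≤ √2 |defect(A)|^{1/2} ‖d^{ξ_f}ψ‖_{L²}
≤ √(6(d+2)) · ξ_c · ‖∇F‖_{L²} ‖dψ‖_{L²}` — rate (coarse spacing)¹, the record's (β)_lin, obtained here from (β′)_lin for `A` AND for `ψ`
by the semidefinite Cauchy–Schwarz `abs_bil_le` instead of the record's Jensen step (§6, `stencil_L2_defect_le_variance`).  (ii) WHAT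
THE RECORD ADDS for Bałaban's non-linear average (15) [analysis, NOT here]: dressings `Ad_{U(γ)}` of the stencil terms (isometries of
the pairing), correction exponentials `c(P) = O(ε₁η²)` and the Bianchi remainder (Appendix β §3–§4, §4.C1), each carrying an extra
`ε₁` or an extra `η` relative to the leading term certified here.  (iii) For the k-fold average (`n = L^k`) the same theorems hold
verbatim (BIJ85 p. 309); the constants `6(d+2)n⁴`, `12(d+2)n^{d+6}` have the sharp POWER of `n` (for fields varying on the
block scale both sides of `abs_deficit_le'` are of the same order) but are not optimised.

NOT CLAIMED.  Nothing about non-abelian fields, `exp`/`log`, holonomies or B7 (15); nothing about minimisers, `H_k`, Green's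
functions or B11; no localisation (the route's δ, `T4ConstrainedAgmon(D)`); no statement of any paper is a hypothesis of any
theorem below; the cell's β for Bałaban's `𝓓` remains [analysis] in the record (GAPS G-ne3p2-1).  Record: HOME/t4/T4-EST-NE3-P2.md
v1.17 §7 item (l), Appendix β v0.5 §5–§6; v1.1 (§6 locality + the cross-read docfixes D-1/D-2/I-1 of C-t4lit2g7-1): record v1.18 §0 (n).
-/

open scoped BigOperators Matrix ComplexConjugate
open Finset Complex

namespace Literature.MathematicalPhysics.QuantumFieldTheory.Balaban1983to89.T4AveragingDeficit

open Literature.MathematicalPhysics.QuantumFieldTheory.Balaban1983to89.B5Prop11Plancherel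
open Literature.MathematicalPhysics.QuantumFieldTheory.Balaban1983to89.B5Action121
open Literature.MathematicalPhysics.QuantumFieldTheory.Balaban1983to89.B5Block118
open Literature.MathematicalPhysics.QuantumFieldTheory.Balaban1983to89.B5Blocks16
open Literature.MathematicalPhysics.QuantumFieldTheory.Balaban1983to89.B5AverageCurlStokes

noncomputable section

/-! ## §1 Pair-variance algebra over a finite index set (complex values) -/

section PairVariance

variable {ι : Type*} [Fintype ι]

/-- The real pairing `Re (conj a · b)` of two complex numbers (the real scalar product of `ℂ ≅ ℝ²`). [folklore] -/
def rin (a b : ℂ) : ℝ := (conj a * b).re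

/-- `Re(conj a · a) = ‖a‖²`. [folklore] -/
theorem rin_self (a : ℂ) : rin a a = ‖a‖ ^ 2 := by
  rw [rin, conj_mul', ← ofReal_pow, ofReal_re]

/-- The real pairing is symmetric. [folklore] -/
theorem rin_comm (a b : ℂ) : rin a b = rin b a := by
  rw [rin, rin, ← conj_conj (conj a * b), map_mul, conj_conj, mul_comm, conj_re]

/-- Additivity of the real pairing (left, differences). [folklore] -/
theorem rin_sub_left (a a' b : ℂ) : rin (a - a') b = rin a b - rin a' b := by
  simp [rin, sub_mul]

/-- Additivity of the real pairing (right, differences). [folklore] -/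
theorem rin_sub_right (a b b' : ℂ) : rin a (b - b') = rin a b - rin a b' := by
  simp [rin, mul_sub]

/-- Additivity of the real pairing (right, sums). [folklore] -/
theorem rin_add_right (a b b' : ℂ) : rin a (b + b') = rin a b + rin a b' := by
  simp [rin, mul_add]

/-- Real homogeneity of the real pairing. [folklore] -/
theorem rin_smul_right (a b : ℂ) (s : ℝ) : rin a ((s : ℂ) * b) = s * rin a b := by
  simp [rin, mul_left_comm]

omit [Fintype ι] in
/-- The real pairing of a finite sum (left). [folklore] -/
theorem rin_sum_left (s : Finset ι) (a : ι → ℂ) (b : ℂ) : rin (∑ i ∈ s, a i) b = ∑ i ∈ s, rin (a i) b := by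
  simp [rin, map_sum, Finset.sum_mul, Complex.re_sum]

omit [Fintype ι] in
/-- The real pairing of a finite sum (right). [folklore] -/
theorem rin_sum_right (s : Finset ι) (a : ℂ) (b : ι → ℂ) : rin a (∑ i ∈ s, b i) = ∑ i ∈ s, rin a (b i) := by
  simp [rin, Finset.mul_sum, Complex.re_sum]

/-- `|Re(conj a · b)| ≤ ‖a‖ ‖b‖`. [folklore] -/
theorem abs_rin_le (a b : ℂ) : |rin a b| ≤ ‖a‖ * ‖b‖ := by
  rw [rin]
  calc |(conj a * b).re| ≤ ‖conj a * b‖ := Complex.abs_re_le_norm _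
    _ = ‖a‖ * ‖b‖ := by rw [norm_mul, norm_conj]

/-- `‖a − b‖² = ‖a‖² + ‖b‖² − 2 Re(conj a · b)`. [folklore] -/
theorem normSq_sub_eq (a b : ℂ) : ‖a - b‖ ^ 2 = ‖a‖ ^ 2 + ‖b‖ ^ 2 - 2 * rin a b := by
  rw [← rin_self, rin_sub_left, rin_sub_right, rin_sub_right, rin_self, rin_self, rin_comm b a]
  ring

/-- `‖a + s b‖² = ‖a‖² + 2 s Re(conj a · b) + s² ‖b‖²` for real `s`. [folklore] -/
theorem normSq_add_smul (a b : ℂ) (s : ℝ) :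
    ‖a + (s : ℂ) * b‖ ^ 2 = ‖a‖ ^ 2 + 2 * s * rin a b + s ^ 2 * ‖b‖ ^ 2 := by
  rw [← rin_self, show a + (s : ℂ) * b = a - (-(s : ℂ) * b) by ring, rin_sub_left, rin_sub_right,
    rin_sub_right]
  have h1 : rin a (-(s : ℂ) * b) = -(s * rin a b) := by
    rw [show -(s : ℂ) * b = ((-s : ℝ) : ℂ) * b by push_cast; ring, rin_smul_right]; ring
  have h2 : rin (-(s : ℂ) * b) a = -(s * rin a b) := by rw [rin_comm, h1]
  have h3 : rin (-(s : ℂ) * b) (-(s : ℂ) * b) = s ^ 2 * ‖b‖ ^ 2 := by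
    rw [rin_self, norm_mul, norm_neg, Complex.norm_real, mul_pow, Real.norm_eq_abs, sq_abs]
  rw [h1, h2, h3, rin_self]
  ring

/-- THE PAIR FORM OF A PRODUCT OF SUMS: `Re(conj(Σ a)(Σ b)) − N·Σ Re(conj aᵢ bᵢ) = Σᵢ Σⱼ Re(conj(aⱼ − aᵢ)·bᵢ)`
(`N = #ι`). [folklore] -/
theorem rin_sum_sum_sub (a b : ι → ℂ) :
    rin (∑ i, a i) (∑ i, b i) - Fintype.card ι * ∑ i, rin (a i) (b i)
      = ∑ i, ∑ j, rin (a j - a i) (b i) := by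
  simp_rw [rin_sub_left, Finset.sum_sub_distrib, Finset.sum_const, Finset.card_univ, nsmul_eq_mul]
  rw [rin_sum_right]
  simp_rw [rin_sum_left]
  rw [Finset.sum_comm, Finset.mul_sum]

/-- The same pair sum, ANTISYMMETRISED: `Σᵢ Σⱼ Re(conj(aⱼ − aᵢ)·bᵢ) = −½ Σᵢ Σⱼ Re(conj(aⱼ − aᵢ)(bⱼ − bᵢ))`. [folklore] -/
theorem sum_sum_rin_sub_eq (a b : ι → ℂ) :
    ∑ i, ∑ j, rin (a j - a i) (b i) = -(1 / 2) * ∑ i, ∑ j, rin (a j - a i) (b j - b i) := by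
  have hswap : ∑ i, ∑ j, rin (a j - a i) (b i) = -∑ i, ∑ j, rin (a j - a i) (b j) := by
    rw [Finset.sum_comm, ← Finset.sum_neg_distrib]
    refine Finset.sum_congr rfl fun i _ => ?_
    rw [← Finset.sum_neg_distrib]
    refine Finset.sum_congr rfl fun j _ => ?_
    rw [show a i - a j = -(a j - a i) by ring, rin, map_neg, neg_mul, neg_re, rin]
  have hsplit : ∑ i, ∑ j, rin (a j - a i) (b j - b i)
      = ∑ i, ∑ j, rin (a j - a i) (b j) - ∑ i, ∑ j, rin (a j - a i) (b i) := by
    rw [← Finset.sum_sub_distrib]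
    refine Finset.sum_congr rfl fun i _ => ?_
    rw [← Finset.sum_sub_distrib]
    refine Finset.sum_congr rfl fun j _ => ?_
    rw [rin_sub_right]
  rw [hsplit, hswap]
  ring

/-- The PAIR VARIANCE of a finite complex family: `Σᵢ Σⱼ ‖aⱼ − aᵢ‖²`. [folklore] -/
def pvar (a : ι → ℂ) : ℝ := ∑ i, ∑ j, ‖a j - a i‖ ^ 2

/-- The pair variance is non-negative. [folklore] -/
theorem pvar_nonneg (a : ι → ℂ) : 0 ≤ pvar a :=
  Finset.sum_nonneg fun _ _ => Finset.sum_nonneg fun _ _ => sq_nonneg _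

/-- PAIR-VARIANCE IDENTITY: `‖Σ a‖² = N·Σ‖aᵢ‖² − ½·Σᵢ Σⱼ ‖aⱼ − aᵢ‖²`. [folklore] -/
theorem normSq_sum_eq (a : ι → ℂ) :
    ‖∑ i, a i‖ ^ 2 = Fintype.card ι * ∑ i, ‖a i‖ ^ 2 - (1 / 2) * pvar a := by
  have h := rin_sum_sum_sub a a
  rw [sum_sum_rin_sub_eq] at h
  simp_rw [rin_self] at h
  rw [pvar]
  linarith

/-- CAUCHY–SCHWARZ FOR THE PAIR FORM: `|Re(conj(Σa)(Σb)) − N·Σ Re(conj aᵢ bᵢ)| ≤ ½ √(pvar a) √(pvar b)`. [folklore] -/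
theorem abs_rin_sum_sum_sub_le (a b : ι → ℂ) :
    |rin (∑ i, a i) (∑ i, b i) - Fintype.card ι * ∑ i, rin (a i) (b i)|
      ≤ (1 / 2) * Real.sqrt (pvar a) * Real.sqrt (pvar b) := by
  rw [rin_sum_sum_sub, sum_sum_rin_sub_eq, abs_mul, abs_neg, abs_of_pos (by norm_num : (0:ℝ) < 1 / 2),
    mul_assoc]
  refine mul_le_mul_of_nonneg_left ?_ (by norm_num)
  -- flatten to a sum over pairs and apply Cauchy–Schwarz
  have hflat : ∑ i, ∑ j, rin (a j - a i) (b j - b i) = ∑ p : ι × ι, rin (a p.2 - a p.1) (b p.2 - b p.1) := by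
    rw [Fintype.sum_prod_type]
  have hpa : pvar a = ∑ p : ι × ι, ‖a p.2 - a p.1‖ ^ 2 := by rw [pvar, Fintype.sum_prod_type]
  have hpb : pvar b = ∑ p : ι × ι, ‖b p.2 - b p.1‖ ^ 2 := by rw [pvar, Fintype.sum_prod_type]
  rw [hflat, hpa, hpb]
  calc |∑ p : ι × ι, rin (a p.2 - a p.1) (b p.2 - b p.1)|
      ≤ ∑ p : ι × ι, |rin (a p.2 - a p.1) (b p.2 - b p.1)| := Finset.abs_sum_le_sum_abs _ _
    _ ≤ ∑ p : ι × ι, ‖a p.2 - a p.1‖ * ‖b p.2 - b p.1‖ := Finset.sum_le_sum fun p _ => abs_rin_le _ _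
    _ ≤ Real.sqrt (∑ p : ι × ι, ‖a p.2 - a p.1‖ ^ 2) * Real.sqrt (∑ p : ι × ι, ‖b p.2 - b p.1‖ ^ 2) :=
        Real.sum_mul_le_sqrt_mul_sqrt _ _ _
    _ = _ := by rfl

end PairVariance

/-! ## §2 The stencil of the block average: coarse plaquette = `n^{-(d+1)}` × the sum of the `n^{d+2}` fine plaquette
variables of the stencil; the counting identity; the EXACT DEFICIT IDENTITY -/

section Stencil

variable {d : ℕ} (n : ℕ) [NeZero n] (M : Fin d → ℕ) [hM : ∀ μ, NeZero (M μ)]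

/-- The stencil index of one coarse plaquette: a block offset `j ∈ {0,…,n−1}^d` and a position `(s, t)`, `s, t < n`, in the
`n × n` square of fine plaquettes based at the block point. [folklore] -/
abbrev Off (d n : ℕ) : Type := (Fin d → Fin n) × Fin n × Fin n

omit [NeZero n] in
/-- `#Off = n^{d+2}`. [folklore] -/
theorem card_Off : Fintype.card (Off d n) = n ^ (d + 2) := by
  rw [Fintype.card_prod, Fintype.card_prod, Fintype.card_fun, Fintype.card_fin, Fintype.card_fin]
  ring

/-- The stencil point `X_y(P) = n·y + j + s e_μ + t e_ν` — the base point of the fine plaquette `P = (j, s, t)` of the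
stencil of the coarse plaquette at `y` in the `(μ, ν)` plane. [folklore] -/
def spt (μ ν : Fin d) (y : Tor M) (P : Off d n) : Tor (fine n M) :=
  bpt n M y P.1 + tstep (fine n M) μ P.2.1 + tstep (fine n M) ν P.2.2

omit [NeZero n] hM in
/-- Unfolding lemma for the stencil point. [folklore] -/
theorem spt_apply (μ ν : Fin d) (y : Tor M) (j : Fin d → Fin n) (s t : Fin n) :
    spt n M μ ν y (j, s, t) = bpt n M y j + tstep (fine n M) μ s + tstep (fine n M) ν t := rfl

omit [NeZero n] hM in
/-- A sum over the stencil is a triple sum. [folklore] -/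
theorem sum_Off {β : Type*} [AddCommMonoid β] (f : Off d n → β) :
    ∑ P, f P = ∑ j : Fin d → Fin n, ∑ s : Fin n, ∑ t : Fin n, f (j, s, t) := by
  rw [Fintype.sum_prod_type]
  exact Finset.sum_congr rfl fun j _ => Fintype.sum_prod_type _

omit [NeZero n] hM in
/-- `Σ_j squareSum A (n·y + j) = Σ_P plaq A (X_y P)`. [folklore] -/
theorem sum_squareSum_eq (A : Tor (fine n M) × Fin d → ℂ) (μ ν : Fin d) (y : Tor M) :
    ∑ j : Fin d → Fin n, squareSum n M A μ ν (bpt n M y j)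
      = ∑ P : Off d n, plaq (fine n M) A μ ν (spt n M μ ν y P) := by
  rw [sum_Off]
  rfl

/-- §3 of `B5AverageCurlStokes` IN STENCIL FORM: the unit-lattice plaquette variable of `Q_kA` is `n^{-(d+1)}` times the
sum of the `n^{d+2}` fine plaquette variables of its stencil.
[cite: Balaban1984PropagatorsI, (1.18) p. 20; Federbush1986PhaseCellI, (1.3)–(1.4) p. 322] -/
theorem plaq_QvOp_spt (A : Tor (fine n M) × Fin d → ℂ) (μ ν : Fin d) (y : Tor M) :
    plaq M (QvOp n M *ᵥ A) μ ν y
      = 1 / (n : ℂ) ^ (d + 1) * ∑ P : Off d n, plaq (fine n M) A μ ν (spt n M μ ν y P) := by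
  rw [plaq_QvOp, sum_squareSum_eq]

/-- THE COUNTING IDENTITY: every fine site is the stencil point `X_y(P)` of exactly `n²` pairs `(y, P)`:
`Σ_y Σ_P g(X_y P) = n² Σ_x g(x)` (block partition + translation invariance). [folklore] -/
theorem sum_sum_spt (μ ν : Fin d) (g : Tor (fine n M) → ℝ) :
    ∑ y : Tor M, ∑ P : Off d n, g (spt n M μ ν y P) = (n : ℝ) ^ 2 * ∑ x : Tor (fine n M), g x := by
  simp_rw [sum_Off, spt_apply]
  rw [sum_comm_22 (fun (y : Tor M) (j : Fin d → Fin n) (s : Fin n) (t : Fin n) =>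
    g (bpt n M y j + tstep (fine n M) μ s + tstep (fine n M) ν t))]
  have step : ∀ s t : Fin n, ∑ y : Tor M, ∑ j : Fin d → Fin n,
      g (bpt n M y j + tstep (fine n M) μ s + tstep (fine n M) ν t) = ∑ x : Tor (fine n M), g x := by
    intro s t
    rw [← sum_blocks_real n M (fun x => g (x + tstep (fine n M) μ s + tstep (fine n M) ν t))]
    simp_rw [add_assoc]
    exact sum_translate n M g _
  simp_rw [step]
  simp only [Finset.sum_const, Finset.card_univ, Fintype.card_fin, nsmul_eq_mul]
  ring

/-- `Σ_y Σ_j g(n·y + j + c) = Σ_x g(x)` (block partition, then translation by the fixed offset `c`). [folklore] -/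
theorem sum_sum_bpt_add (g : Tor (fine n M) → ℝ) (c : Tor (fine n M)) :
    ∑ y : Tor M, ∑ j : Fin d → Fin n, g (bpt n M y j + c) = ∑ x : Tor (fine n M), g x := by
  rw [← sum_blocks_real n M (fun x => g (x + c))]
  exact sum_translate n M g c

/-- THE STENCIL PAIR-VARIANCE of a fine plaquette function `θ` in the `(μ, ν)` plane:
`W(θ) = Σ_y Σ_P Σ_{P′} ‖θ(X_y P′) − θ(X_y P)‖²`. [folklore] -/
def W (μ ν : Fin d) (θ : Tor (fine n M) → ℂ) : ℝ :=
  ∑ y : Tor M, pvar (fun P : Off d n => θ (spt n M μ ν y P))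

omit [NeZero n] in
/-- `0 ≤ W(θ)`. [folklore] -/
theorem W_nonneg (μ ν : Fin d) (θ : Tor (fine n M) → ℂ) : 0 ≤ W n M μ ν θ :=
  Finset.sum_nonneg fun _ _ => pvar_nonneg _

/-- THE (NORMALISED) ONE-STEP ABELIAN ACTION DEFICIT of the block average in the `(μ, ν)` plane:
`deficit A = n^d · Σ_y ‖plaq (Q_kA) μ ν y‖² − n² · Σ_x ‖plaq A μ ν x‖²` — the two sides of `B5AverageCurlStokes.sum_normSq_plaq_QvOp_le`
(Federbush's stability theorem says `deficit ≤ 0`).  In Wilson units (`S^ξ = ½ Σ_p ξ^{d−4} ϑ_p²`, plaquette ANGLES `ϑ = n^{-1}·plaq A`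
on the fine lattice of spacing `ξ_f`, coarse spacing `ξ_c = n ξ_f`): `S^{ξ_c}(Q_kA) − S^{ξ_f}(A) = ½ n^{-d} ξ_c^{d−4} · deficit`
summed over the planes `μ < ν`. [folklore] -/
def deficit (A : Tor (fine n M) × Fin d → ℂ) (μ ν : Fin d) : ℝ :=
  (n : ℝ) ^ d * ∑ y : Tor M, ‖plaq M (QvOp n M *ᵥ A) μ ν y‖ ^ 2
    - (n : ℝ) ^ 2 * ∑ x : Tor (fine n M), ‖plaq (fine n M) A μ ν x‖ ^ 2

/-- Federbush's Abelian Stability Theorem (tree: `B5AverageCurlStokes.sum_normSq_plaq_QvOp_le`) in this notation: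
`deficit ≤ 0`. [cite: Federbush1986PhaseCellI, 'Abelian Stability Theorem' (0.12) p. 321] -/
theorem deficit_nonpos (A : Tor (fine n M) × Fin d → ℂ) (μ ν : Fin d) : deficit n M A μ ν ≤ 0 :=
  sub_nonpos.mpr (sum_normSq_plaq_QvOp_le n M A μ ν)

/-- THE EXACT DEFICIT IDENTITY («averaging decreases the action» WITH THE DEFICIT MADE EXPLICIT):
`n^d Σ_y ‖plaq(Q_kA)‖² − n² Σ_x ‖plaq A‖² = −½ n^{-(d+2)} · W(plaq A)` — the action lost in one averaging step is
exactly `½ n^{-(d+2)}` times the stencil pair-variance of the fine plaquette field. [folklore] -/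
theorem deficit_eq (A : Tor (fine n M) × Fin d → ℂ) (μ ν : Fin d) :
    deficit n M A μ ν = -(1 / 2) * (1 / (n : ℝ) ^ (d + 2)) * W n M μ ν (plaq (fine n M) A μ ν) := by
  have hn : (0 : ℝ) < n := by exact_mod_cast Nat.pos_of_ne_zero (NeZero.ne n)
  set θ := plaq (fine n M) A μ ν with hθ
  have hpt : ∀ y : Tor M, ‖plaq M (QvOp n M *ᵥ A) μ ν y‖ ^ 2
      = (1 / (n : ℝ) ^ (d + 1)) ^ 2 * ((n : ℝ) ^ (d + 2) * ∑ P : Off d n, ‖θ (spt n M μ ν y P)‖ ^ 2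
          - (1 / 2) * pvar (fun P : Off d n => θ (spt n M μ ν y P))) := by
    intro y
    rw [plaq_QvOp_spt, norm_mul, mul_pow]
    have hc : ‖(1 : ℂ) / (n : ℂ) ^ (d + 1)‖ = 1 / (n : ℝ) ^ (d + 1) := by
      rw [norm_div, norm_one, norm_pow, Complex.norm_natCast]
    rw [hc, normSq_sum_eq, card_Off]
    push_cast
    rfl
  rw [deficit, Finset.sum_congr rfl fun y _ => hpt y, ← Finset.mul_sum, Finset.sum_sub_distrib, ← Finset.mul_sum,
    ← Finset.mul_sum, sum_sum_spt n M μ ν (fun x => ‖θ x‖ ^ 2), W]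
  field_simp
  ring

end Stencil

/-! ## §3 The DERIVATIVE of the deficit: exact polarisation, and `|B(A,ψ)|² ≤ |deficit A| · |deficit ψ|`
((β)_lin ⇐ (β′)_lin by semidefiniteness) -/

section Polarisation

variable {d : ℕ} (n : ℕ) [NeZero n] (M : Fin d → ℕ) [hM : ∀ μ, NeZero (M μ)]

/-- The polar (bilinear) form of the deficit: `B(A,ψ) = n^d Σ_y Re(conj plaq(Q_kA)·plaq(Q_kψ)) − n² Σ_x Re(conj plaq A · plaq ψ)`;
`2·B(A,ψ)` is the derivative `d/ds|₀ deficit(A + sψ)` (`deficit_add_smul`). [folklore] -/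
def bil (A ψ : Tor (fine n M) × Fin d → ℂ) (μ ν : Fin d) : ℝ :=
  (n : ℝ) ^ d * ∑ y : Tor M, rin (plaq M (QvOp n M *ᵥ A) μ ν y) (plaq M (QvOp n M *ᵥ ψ) μ ν y)
    - (n : ℝ) ^ 2 * ∑ x : Tor (fine n M), rin (plaq (fine n M) A μ ν x) (plaq (fine n M) ψ μ ν x)

omit hM in
/-- `plaq` is real-linear. [folklore] -/
theorem plaq_add_smul {N : Fin d → ℕ} (A ψ : Tor N × Fin d → ℂ) (s : ℝ) (μ ν : Fin d) (x : Tor N) :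
    plaq N (A + (s : ℂ) • ψ) μ ν x = plaq N A μ ν x + (s : ℂ) * plaq N ψ μ ν x := by
  simp only [plaq, Pi.add_apply, Pi.smul_apply, smul_eq_mul]
  ring

/-- `Q_k` is linear: `Q_k(A + sψ) = Q_kA + s Q_kψ`. [folklore] -/
theorem QvOp_add_smul (A ψ : Tor (fine n M) × Fin d → ℂ) (s : ℝ) :
    QvOp n M *ᵥ (A + (s : ℂ) • ψ) = QvOp n M *ᵥ A + (s : ℂ) • (QvOp n M *ᵥ ψ) := by
  rw [Matrix.mulVec_add, Matrix.mulVec_smul]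

/-- EXACT SECOND-ORDER EXPANSION (the deficit is a quadratic form; no calculus, no junk values):
`deficit(A + sψ) = deficit A + 2s·B(A,ψ) + s²·deficit ψ` for every real `s`. [folklore] -/
theorem deficit_add_smul (A ψ : Tor (fine n M) × Fin d → ℂ) (s : ℝ) (μ ν : Fin d) :
    deficit n M (A + (s : ℂ) • ψ) μ ν
      = deficit n M A μ ν + 2 * s * bil n M A ψ μ ν + s ^ 2 * deficit n M ψ μ ν := by
  have hf : ∀ x : Tor (fine n M), ‖plaq (fine n M) (A + (s : ℂ) • ψ) μ ν x‖ ^ 2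
      = ‖plaq (fine n M) A μ ν x‖ ^ 2 + 2 * s * rin (plaq (fine n M) A μ ν x) (plaq (fine n M) ψ μ ν x)
        + s ^ 2 * ‖plaq (fine n M) ψ μ ν x‖ ^ 2 := fun x => by
    rw [plaq_add_smul, normSq_add_smul]
  have hc : ∀ y : Tor M, ‖plaq M (QvOp n M *ᵥ (A + (s : ℂ) • ψ)) μ ν y‖ ^ 2
      = ‖plaq M (QvOp n M *ᵥ A) μ ν y‖ ^ 2
        + 2 * s * rin (plaq M (QvOp n M *ᵥ A) μ ν y) (plaq M (QvOp n M *ᵥ ψ) μ ν y)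
        + s ^ 2 * ‖plaq M (QvOp n M *ᵥ ψ) μ ν y‖ ^ 2 := fun y => by
    rw [QvOp_add_smul, plaq_add_smul, normSq_add_smul]
  simp only [deficit, bil, hf, hc, Finset.sum_add_distrib, ← Finset.mul_sum]
  ring

omit [NeZero n] hM in
/-- Scaling of the pairing by a real factor written as a complex number: `rin (c a) (c b) = ‖c‖² rin a b` for `c = 1/n^{d+1}`. [folklore] -/
theorem rin_mul_mul_inv_pow (a b : ℂ) (m : ℕ) :
    rin (1 / (n : ℂ) ^ m * a) (1 / (n : ℂ) ^ m * b) = (1 / (n : ℝ) ^ m) ^ 2 * rin a b := by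
  rw [rin, rin, map_mul]
  have hc : conj (1 / (n : ℂ) ^ m) = 1 / (n : ℂ) ^ m := by
    rw [map_div₀, map_one, map_pow, Complex.conj_natCast]
  rw [hc, show (1 / (n : ℂ) ^ m * conj a) * (1 / (n : ℂ) ^ m * b) = (1 / (n : ℂ) ^ m) ^ 2 * (conj a * b) by ring]
  have hr : ((1 / (n : ℂ) ^ m) ^ 2 : ℂ) = (((1 / (n : ℝ) ^ m) ^ 2 : ℝ) : ℂ) := by push_cast; ring
  rw [hr, Complex.re_ofReal_mul]

/-- THE POLAR FORM IN PAIR FORM: `B(A,ψ) = n^{-(d+2)} Σ_y [Re(conj(Σ_P θ(X_yP))(Σ_P φ(X_yP))) − n^{d+2} Σ_P Re(conj θ(X_yP) φ(X_yP))]`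
with `θ = plaq A`, `φ = plaq ψ` (the `n² Σ_x` term redistributed over the stencils by the counting identity). [folklore] -/
theorem bil_eq (A ψ : Tor (fine n M) × Fin d → ℂ) (μ ν : Fin d) :
    bil n M A ψ μ ν = 1 / (n : ℝ) ^ (d + 2) * ∑ y : Tor M,
      (rin (∑ P : Off d n, plaq (fine n M) A μ ν (spt n M μ ν y P)) (∑ P : Off d n, plaq (fine n M) ψ μ ν (spt n M μ ν y P))
        - Fintype.card (Off d n) * ∑ P : Off d n,
            rin (plaq (fine n M) A μ ν (spt n M μ ν y P)) (plaq (fine n M) ψ μ ν (spt n M μ ν y P))) := by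
  have hn : (0 : ℝ) < n := by exact_mod_cast Nat.pos_of_ne_zero (NeZero.ne n)
  rw [bil, ← sum_sum_spt n M μ ν (fun x => rin (plaq (fine n M) A μ ν x) (plaq (fine n M) ψ μ ν x)), card_Off,
    Finset.mul_sum, Finset.mul_sum, ← Finset.sum_sub_distrib]
  refine Finset.sum_congr rfl fun y _ => ?_
  rw [plaq_QvOp_spt, plaq_QvOp_spt, rin_mul_mul_inv_pow]
  push_cast
  field_simp
  ring

/-- `|B(A,ψ)| ≤ ½ n^{-(d+2)} √W(plaq A) √W(plaq ψ)` (Cauchy–Schwarz for the pair form, stencil by stencil, then over `y`). [folklore] -/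
theorem abs_bil_le_sqrt_W (A ψ : Tor (fine n M) × Fin d → ℂ) (μ ν : Fin d) :
    |bil n M A ψ μ ν| ≤ (1 / 2) * (1 / (n : ℝ) ^ (d + 2))
      * Real.sqrt (W n M μ ν (plaq (fine n M) A μ ν)) * Real.sqrt (W n M μ ν (plaq (fine n M) ψ μ ν)) := by
  have hn : (0 : ℝ) < n := by exact_mod_cast Nat.pos_of_ne_zero (NeZero.ne n)
  set θ := plaq (fine n M) A μ ν
  set φ := plaq (fine n M) ψ μ ν
  rw [bil_eq, abs_mul, abs_of_pos (by positivity : (0 : ℝ) < 1 / (n : ℝ) ^ (d + 2))]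
  have hy : ∀ y : Tor M,
      |rin (∑ P : Off d n, θ (spt n M μ ν y P)) (∑ P : Off d n, φ (spt n M μ ν y P))
        - Fintype.card (Off d n) * ∑ P : Off d n, rin (θ (spt n M μ ν y P)) (φ (spt n M μ ν y P))|
      ≤ (1 / 2) * (Real.sqrt (pvar (fun P : Off d n => θ (spt n M μ ν y P)))
          * Real.sqrt (pvar (fun P : Off d n => φ (spt n M μ ν y P)))) := by
    intro y
    have h := abs_rin_sum_sum_sub_le (fun P : Off d n => θ (spt n M μ ν y P)) (fun P : Off d n => φ (spt n M μ ν y P))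
    linarith [h]
  have hsum := (Finset.abs_sum_le_sum_abs _ _).trans (Finset.sum_le_sum fun y (_ : y ∈ Finset.univ) => hy y)
  rw [← Finset.mul_sum] at hsum
  have hcs : ∑ y : Tor M, Real.sqrt (pvar (fun P : Off d n => θ (spt n M μ ν y P)))
        * Real.sqrt (pvar (fun P : Off d n => φ (spt n M μ ν y P)))
      ≤ Real.sqrt (W n M μ ν θ) * Real.sqrt (W n M μ ν φ) := by
    have h := Real.sum_mul_le_sqrt_mul_sqrt Finset.univ
      (fun y : Tor M => Real.sqrt (pvar (fun P : Off d n => θ (spt n M μ ν y P))))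
      (fun y : Tor M => Real.sqrt (pvar (fun P : Off d n => φ (spt n M μ ν y P))))
    simp only [Real.sq_sqrt (pvar_nonneg _)] at h
    exact h
  calc 1 / (n : ℝ) ^ (d + 2) * |∑ y : Tor M, (rin (∑ P : Off d n, θ (spt n M μ ν y P)) (∑ P : Off d n, φ (spt n M μ ν y P))
          - Fintype.card (Off d n) * ∑ P : Off d n, rin (θ (spt n M μ ν y P)) (φ (spt n M μ ν y P)))|
      ≤ 1 / (n : ℝ) ^ (d + 2) * ((1 / 2) * ∑ y : Tor M, Real.sqrt (pvar (fun P : Off d n => θ (spt n M μ ν y P)))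
          * Real.sqrt (pvar (fun P : Off d n => φ (spt n M μ ν y P)))) :=
        mul_le_mul_of_nonneg_left hsum (by positivity)
    _ ≤ 1 / (n : ℝ) ^ (d + 2) * ((1 / 2) * (Real.sqrt (W n M μ ν θ) * Real.sqrt (W n M μ ν φ))) := by
        gcongr
    _ = _ := by ring

/-- `W(plaq A) = 2 n^{d+2} |deficit A|` (the deficit identity read backwards). [folklore] -/
theorem W_plaq_eq (A : Tor (fine n M) × Fin d → ℂ) (μ ν : Fin d) :
    W n M μ ν (plaq (fine n M) A μ ν) = 2 * (n : ℝ) ^ (d + 2) * |deficit n M A μ ν| := by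
  have hn : (0 : ℝ) < n := by exact_mod_cast Nat.pos_of_ne_zero (NeZero.ne n)
  rw [abs_of_nonpos (deficit_nonpos n M A μ ν), deficit_eq]
  field_simp

/-- (β)_lin ⇐ (β′)_lin AT MODEL LEVEL: the derivative of the deficit is controlled by its VALUES —
`|B(A,ψ)| ≤ √|deficit A| · √|deficit ψ|` (Cauchy–Schwarz for the negative-semidefinite quadratic form `deficit`). [folklore] -/
theorem abs_bil_le (A ψ : Tor (fine n M) × Fin d → ℂ) (μ ν : Fin d) :
    |bil n M A ψ μ ν| ≤ Real.sqrt |deficit n M A μ ν| * Real.sqrt |deficit n M ψ μ ν| := by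
  have hn : (0 : ℝ) < n := by exact_mod_cast Nat.pos_of_ne_zero (NeZero.ne n)
  have h := abs_bil_le_sqrt_W n M A ψ μ ν
  rw [W_plaq_eq, W_plaq_eq] at h
  have hs : ∀ t : ℝ, 0 ≤ t → Real.sqrt (2 * (n : ℝ) ^ (d + 2) * t) = Real.sqrt (2 * (n : ℝ) ^ (d + 2)) * Real.sqrt t :=
    fun t _ => Real.sqrt_mul (by positivity) t
  rw [hs _ (abs_nonneg _), hs _ (abs_nonneg _)] at h
  have h2 : Real.sqrt (2 * (n : ℝ) ^ (d + 2)) * Real.sqrt (2 * (n : ℝ) ^ (d + 2)) = 2 * (n : ℝ) ^ (d + 2) :=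
    Real.mul_self_sqrt (by positivity)
  calc |bil n M A ψ μ ν|
      ≤ 1 / 2 * (1 / (n : ℝ) ^ (d + 2)) * (Real.sqrt (2 * (n : ℝ) ^ (d + 2)) * Real.sqrt |deficit n M A μ ν|)
          * (Real.sqrt (2 * (n : ℝ) ^ (d + 2)) * Real.sqrt |deficit n M ψ μ ν|) := h
    _ = (1 / 2 * (1 / (n : ℝ) ^ (d + 2)) * (Real.sqrt (2 * (n : ℝ) ^ (d + 2)) * Real.sqrt (2 * (n : ℝ) ^ (d + 2))))
          * (Real.sqrt |deficit n M A μ ν| * Real.sqrt |deficit n M ψ μ ν|) := by ring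
    _ = Real.sqrt |deficit n M A μ ν| * Real.sqrt |deficit n M ψ μ ν| := by
        rw [h2]; field_simp

/-- Squared form: `B(A,ψ)² ≤ |deficit A| · |deficit ψ|`. [folklore] -/
theorem sq_bil_le (A ψ : Tor (fine n M) × Fin d → ℂ) (μ ν : Fin d) :
    bil n M A ψ μ ν ^ 2 ≤ |deficit n M A μ ν| * |deficit n M ψ μ ν| := by
  have h := abs_bil_le n M A ψ μ ν
  have h0 : 0 ≤ Real.sqrt |deficit n M A μ ν| * Real.sqrt |deficit n M ψ μ ν| := by positivity
  calc bil n M A ψ μ ν ^ 2 = |bil n M A ψ μ ν| ^ 2 := (sq_abs _).symm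
    _ ≤ (Real.sqrt |deficit n M A μ ν| * Real.sqrt |deficit n M ψ μ ν|) ^ 2 := by
        gcongr
    _ = |deficit n M A μ ν| * |deficit n M ψ μ ν| := by
        rw [mul_pow, Real.sq_sqrt (abs_nonneg _), Real.sq_sqrt (abs_nonneg _)]

/-- The deficit of the DIRECTION is at most its fine action: `|deficit ψ| ≤ n² Σ_x ‖plaq ψ‖²`. [folklore] -/
theorem abs_deficit_le_fine (ψ : Tor (fine n M) × Fin d → ℂ) (μ ν : Fin d) :
    |deficit n M ψ μ ν| ≤ (n : ℝ) ^ 2 * ∑ x : Tor (fine n M), ‖plaq (fine n M) ψ μ ν x‖ ^ 2 := by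
  rw [abs_of_nonpos (deficit_nonpos n M ψ μ ν), deficit, neg_sub]
  have h0 : 0 ≤ (n : ℝ) ^ d * ∑ y : Tor M, ‖plaq M (QvOp n M *ᵥ ψ) μ ν y‖ ^ 2 := by positivity
  linarith

/-- THE DERIVATIVE BOUND IN ENERGY CURRENCY: `|B(A,ψ)| ≤ √|deficit A| · n · (Σ_x ‖plaq ψ‖²)^{1/2}` — the derivative of the
one-step abelian action deficit at `A` in the direction `ψ` is at most (the square root of the action LOST at `A`) times the
fine curl-energy norm of `ψ`.  With §4 (`|deficit A| ≤ C n⁴ Σ_κ ‖δ_κ plaq A‖²`) this is the model form of the cell's (β):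
rate = one fine-lattice difference of the plaquette field. [folklore] -/
theorem abs_bil_le_energy (A ψ : Tor (fine n M) × Fin d → ℂ) (μ ν : Fin d) :
    |bil n M A ψ μ ν| ≤ Real.sqrt |deficit n M A μ ν|
      * ((n : ℝ) * Real.sqrt (∑ x : Tor (fine n M), ‖plaq (fine n M) ψ μ ν x‖ ^ 2)) := by
  have hn : (0 : ℝ) ≤ n := by positivity
  refine (abs_bil_le n M A ψ μ ν).trans (mul_le_mul_of_nonneg_left ?_ (Real.sqrt_nonneg _))
  rw [show (n : ℝ) * Real.sqrt (∑ x : Tor (fine n M), ‖plaq (fine n M) ψ μ ν x‖ ^ 2)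
      = Real.sqrt ((n : ℝ) ^ 2 * ∑ x : Tor (fine n M), ‖plaq (fine n M) ψ μ ν x‖ ^ 2) by
        rw [Real.sqrt_mul (by positivity), Real.sqrt_sq hn]]
  exact Real.sqrt_le_sqrt (abs_deficit_le_fine n M ψ μ ν)

end Polarisation

/-! ## §4 The STENCIL POINCARÉ INEQUALITY `W(θ) ≤ 12 n^{d+6} (E_μ(θ) + E_ν(θ) + d Σ_κ E_κ(θ))`: the pair-variance of the
stencil is controlled by ONE fine-lattice difference of `θ` (paths: `ν`-offset, `μ`-offset, then the block digits one
direction at a time; exact path counting, no volume loss) -/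

section Poincare

variable {d : ℕ} (n : ℕ) [NeZero n] (M : Fin d → ℕ) [hM : ∀ μ, NeZero (M μ)]

/-- The forward difference `δ_κ θ (x) = θ(x + e_κ) − θ(x)` of a fine-lattice function. [folklore] -/
def fd {N : Fin d → ℕ} (κ : Fin d) (θ : Tor N → ℂ) (x : Tor N) : ℂ := θ (x + unitVec N κ) - θ x

/-- The difference energy `E_κ(θ) = Σ_x ‖δ_κ θ (x)‖²`. [folklore] -/
def dE {N : Fin d → ℕ} [∀ μ, NeZero (N μ)] (κ : Fin d) (θ : Tor N → ℂ) : ℝ := ∑ x : Tor N, ‖fd κ θ x‖ ^ 2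

omit hM in
/-- `0 ≤ E_κ(θ)`. [folklore] -/
theorem dE_nonneg {N : Fin d → ℕ} [∀ μ, NeZero (N μ)] (κ : Fin d) (θ : Tor N → ℂ) : 0 ≤ dE κ θ :=
  Finset.sum_nonneg fun _ _ => sq_nonneg _

/-! ### §4.1 Path combinatorics inside a block: digit hybrids and the exact fibre count -/

/-- The digit hybrid `m_k(a, b) = (b on the digits < k, a on the digits ≥ k)`: `m_0 = a`, `m_d = b`. [folklore] -/
def mrg (k : ℕ) (a b : Fin d → Fin n) : Fin d → Fin n := fun ι => if ι.val < k then b ι else a ι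

/-- The hybrid with digit `κ` set to `i`: `ins κ i a b = (b on digits < κ, i at κ, a on digits > κ)`. [folklore] -/
def ins (κ : Fin d) (i : Fin n) (a b : Fin d → Fin n) : Fin d → Fin n := Function.update (mrg n κ.val a b) κ i

omit [NeZero n] in
/-- `m_0(a, b) = a`. [folklore] -/
theorem mrg_zero (a b : Fin d → Fin n) : mrg n 0 a b = a := by
  funext ι; simp [mrg]

omit [NeZero n] in
/-- `m_d(a, b) = b`. [folklore] -/
theorem mrg_self (a b : Fin d → Fin n) : mrg n d a b = b := by
  funext ι; simp [mrg, ι.isLt]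

omit [NeZero n] in
/-- One more digit: `m_{k+1} = m_k` with digit `κ = k` set to `b κ`. [folklore] -/
theorem mrg_succ (κ : Fin d) (a b : Fin d → Fin n) :
    mrg n (κ.val + 1) a b = Function.update (mrg n κ.val a b) κ (b κ) := by
  funext ι
  by_cases h1 : ι = κ
  · subst h1; simp [mrg]
  · have h2 : ι.val ≠ κ.val := fun h => h1 (Fin.ext h)
    rw [Function.update_apply, if_neg h1]
    simp only [mrg]
    by_cases h3 : ι.val < κ.val
    · rw [if_pos (by omega), if_pos h3]
    · rw [if_neg (by omega), if_neg h3]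

omit [NeZero n] in
/-- `m_k` already carries `a κ` at the digit `κ = k`. [folklore] -/
theorem mrg_eq_update (κ : Fin d) (a b : Fin d → Fin n) :
    mrg n κ.val a b = Function.update (mrg n κ.val a b) κ (a κ) := by
  funext ι
  by_cases h1 : ι = κ
  · subst h1; simp [mrg]
  · rw [Function.update_apply, if_neg h1]

omit [NeZero n] in
/-- `#{0,…,n−1}^d = n^d`. [folklore] -/
theorem card_digits : Fintype.card (Fin d → Fin n) = n ^ d := by
  rw [Fintype.card_fun, Fintype.card_fin, Fintype.card_fin]

omit [NeZero n] in
/-- THE EXACT FIBRE COUNT of the digit paths: as `(a, b, i)` ranges over all pairs of block offsets and all digit values,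
the hybrid `ins κ i a b` takes every value exactly `n^{d+1}` times:
`Σ_b Σ_a Σ_i G(ins κ i a b) = n^{d+1} Σ_w G(w)` (an explicit bijection `(a, b, i) ↔ (w, r, e)`). [folklore] -/
theorem sum_ins (κ : Fin d) (G : (Fin d → Fin n) → ℝ) :
    ∑ b : Fin d → Fin n, ∑ a : Fin d → Fin n, ∑ i : Fin n, G (ins n κ i a b)
      = (n : ℝ) ^ (d + 1) * ∑ w : Fin d → Fin n, G w := by
  -- the bijection (b, a, i) ↦ (w, r, e) := (ins κ i a b, mrg κ b a, a κ), inverse (w, r, e) ↦ (mrg κ r w, update (mrg κ w r) κ e, w κ)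
  let e : (Fin d → Fin n) × (Fin d → Fin n) × Fin n ≃ (Fin d → Fin n) × (Fin d → Fin n) × Fin n :=
    { toFun := fun σ => (ins n κ σ.2.2 σ.2.1 σ.1, mrg n κ.val σ.1 σ.2.1, σ.2.1 κ)
      invFun := fun τ => (mrg n κ.val τ.2.1 τ.1, Function.update (mrg n κ.val τ.1 τ.2.1) κ τ.2.2, τ.1 κ)
      left_inv := by
        rintro ⟨b, a, i⟩
        simp only [Prod.mk.injEq]
        refine ⟨?_, ?_, by simp [ins]⟩
        · funext ι
          by_cases h1 : ι = κ
          · subst h1; simp [mrg]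
          · simp only [ins, mrg, Function.update_apply, if_neg h1]
            by_cases h3 : ι.val < κ.val
            · simp [h3]
            · simp [h3]
        · funext ι
          by_cases h1 : ι = κ
          · subst h1; simp [ins]
          · simp only [ins, mrg, Function.update_apply, if_neg h1]
            by_cases h3 : ι.val < κ.val
            · simp [h3]
            · simp [h3]
      right_inv := by
        rintro ⟨w, r, e⟩
        simp only [Prod.mk.injEq]
        refine ⟨?_, ?_, by simp⟩
        · funext ι
          by_cases h1 : ι = κ
          · subst h1; simp [ins]
          · simp only [ins, mrg, Function.update_apply, if_neg h1]
            by_cases h3 : ι.val < κ.val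
            · simp [h3]
            · simp [h3]
        · funext ι
          by_cases h1 : ι = κ
          · subst h1; simp [mrg]
          · simp only [mrg, Function.update_apply, if_neg h1]
            by_cases h3 : ι.val < κ.val
            · simp [h3]
            · simp [h3] }
  have hL : ∑ b : Fin d → Fin n, ∑ a : Fin d → Fin n, ∑ i : Fin n, G (ins n κ i a b)
      = ∑ σ : (Fin d → Fin n) × (Fin d → Fin n) × Fin n, G (ins n κ σ.2.2 σ.2.1 σ.1) := by
    simp only [Fintype.sum_prod_type]
  have hR : (n : ℝ) ^ (d + 1) * ∑ w : Fin d → Fin n, G w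
      = ∑ τ : (Fin d → Fin n) × (Fin d → Fin n) × Fin n, G τ.1 := by
    simp only [Fintype.sum_prod_type, Finset.sum_const, Finset.card_univ, Finset.mul_sum]
    refine Finset.sum_congr rfl fun w _ => ?_
    rw [Fintype.card_prod, card_digits, Fintype.card_fin]
    ring
  rw [hL, hR]
  exact Fintype.sum_equiv e _ _ fun σ => rfl

/-! ### §4.2 Block points with one digit moved -/

omit hM in
/-- Moving one digit of the block offset is a translation: `n·y + j[κ ↦ a] = n·y + j[κ ↦ 0] + a e_κ`. [folklore] -/
theorem bpt_update (y : Tor M) (w : Fin d → Fin n) (κ : Fin d) (a : Fin n) :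
    bpt n M y (Function.update w κ a) = bpt n M y (Function.update w κ 0) + tstep (fine n M) κ (a : ℕ) := by
  funext ν
  simp only [bpt, iota, tstep, Pi.add_apply, Function.update_apply]
  by_cases h : ν = κ
  · subst h; simp
  · simp [h]

/-! ### §4.3 Reindexing the stencil double sum: offsets outermost, block digits innermost -/

omit [NeZero n] in
/-- `Σ_y Σ_P Σ_{P′} F(y, P, P′) = Σ_{s,t,s′,t′} Σ_y Σ_j Σ_{j′} F(y, (j,s,t), (j′,s′,t′))`. [folklore] -/
theorem sum_stencil_reindex (F : Tor M → Off d n → Off d n → ℝ) :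
    ∑ y : Tor M, ∑ P : Off d n, ∑ P' : Off d n, F y P P'
      = ∑ s : Fin n, ∑ t : Fin n, ∑ s' : Fin n, ∑ t' : Fin n,
          ∑ y : Tor M, ∑ j : Fin d → Fin n, ∑ j' : Fin d → Fin n, F y (j, s, t) (j', s', t') := by
  let e : Tor M × Off d n × Off d n ≃ Fin n × Fin n × Fin n × Fin n × Tor M × (Fin d → Fin n) × (Fin d → Fin n) :=
    { toFun := fun σ => (σ.2.1.2.1, σ.2.1.2.2, σ.2.2.2.1, σ.2.2.2.2, σ.1, σ.2.1.1, σ.2.2.1)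
      invFun := fun τ => (τ.2.2.2.2.1, (τ.2.2.2.2.2.1, τ.1, τ.2.1), (τ.2.2.2.2.2.2, τ.2.2.1, τ.2.2.2.1))
      left_inv := fun _ => rfl
      right_inv := fun _ => rfl }
  have hL : ∑ y : Tor M, ∑ P : Off d n, ∑ P' : Off d n, F y P P'
      = ∑ σ : Tor M × Off d n × Off d n, F σ.1 σ.2.1 σ.2.2 := by
    simp only [Fintype.sum_prod_type]
  have hR : ∑ s : Fin n, ∑ t : Fin n, ∑ s' : Fin n, ∑ t' : Fin n,
        ∑ y : Tor M, ∑ j : Fin d → Fin n, ∑ j' : Fin d → Fin n, F y (j, s, t) (j', s', t')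
      = ∑ τ : Fin n × Fin n × Fin n × Fin n × Tor M × (Fin d → Fin n) × (Fin d → Fin n),
          F τ.2.2.2.2.1 (τ.2.2.2.2.2.1, τ.1, τ.2.1) (τ.2.2.2.2.2.2, τ.2.2.1, τ.2.2.2.1) := by
    simp only [Fintype.sum_prod_type]
  rw [hL, hR]
  exact Fintype.sum_equiv e _ _ fun σ => rfl

/-- `Σ_y Σ_j Σ_i g(n·y + j + c_i) = n Σ_x g(x)` (block partition and translation, for each of the `n` offsets `c_i`). [folklore] -/
theorem sum_sum_sum_bpt_add (g : Tor (fine n M) → ℝ) (c : Fin n → Tor (fine n M)) :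
    ∑ y : Tor M, ∑ j : Fin d → Fin n, ∑ i : Fin n, g (bpt n M y j + c i) = (n : ℝ) * ∑ x : Tor (fine n M), g x := by
  calc ∑ y : Tor M, ∑ j : Fin d → Fin n, ∑ i : Fin n, g (bpt n M y j + c i)
      = ∑ y : Tor M, ∑ i : Fin n, ∑ j : Fin d → Fin n, g (bpt n M y j + c i) :=
        Finset.sum_congr rfl fun y _ => Finset.sum_comm
    _ = ∑ i : Fin n, ∑ y : Tor M, ∑ j : Fin d → Fin n, g (bpt n M y j + c i) := Finset.sum_comm
    _ = ∑ i : Fin n, ∑ x : Tor (fine n M), g x := Finset.sum_congr rfl fun i _ => sum_sum_bpt_add n M g (c i)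
    _ = (n : ℝ) * ∑ x : Tor (fine n M), g x := by
        rw [Finset.sum_const, Finset.card_univ, Fintype.card_fin, nsmul_eq_mul]

/-! ### §4.4 One-dimensional telescoping along a lattice direction -/

omit hM in
/-- TELESCOPING + CAUCHY–SCHWARZ along `m` steps in direction `κ`:
`‖θ(z + m e_κ) − θ(z)‖² ≤ m Σ_{i<m} ‖δ_κθ(z + i e_κ)‖²`. [folklore] -/
theorem normSq_sub_tstep_le {N : Fin d → ℕ} [∀ μ, NeZero (N μ)] (θ : Tor N → ℂ) (z : Tor N) (κ : Fin d) (m : ℕ) :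
    ‖θ (z + tstep N κ m) - θ z‖ ^ 2 ≤ m * ∑ i ∈ Finset.range m, ‖fd κ θ (z + tstep N κ i)‖ ^ 2 := by
  have htel : θ (z + tstep N κ m) - θ z = ∑ i ∈ Finset.range m, fd κ θ (z + tstep N κ i) := by
    have h := Finset.sum_range_sub (fun i => θ (z + tstep N κ i)) m
    simp only [tstep_zero, add_zero] at h
    rw [← h]
    refine Finset.sum_congr rfl fun i _ => ?_
    rw [fd, tstep_succ, add_assoc]
  rw [htel]
  calc ‖∑ i ∈ Finset.range m, fd κ θ (z + tstep N κ i)‖ ^ 2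
      ≤ (∑ i ∈ Finset.range m, ‖fd κ θ (z + tstep N κ i)‖) ^ 2 :=
        pow_le_pow_left₀ (norm_nonneg _) (norm_sum_le _ _) 2
    _ ≤ (Finset.range m).card * ∑ i ∈ Finset.range m, ‖fd κ θ (z + tstep N κ i)‖ ^ 2 := sq_sum_le_card_mul_sum_sq
    _ = m * ∑ i ∈ Finset.range m, ‖fd κ θ (z + tstep N κ i)‖ ^ 2 := by rw [Finset.card_range]

omit [NeZero n] hM in
/-- Two points on a lattice segment of length `n` in direction `κ`:
`‖θ(z + a e_κ) − θ(z + b e_κ)‖² ≤ 4n Σ_{i<n} ‖δ_κθ(z + i e_κ)‖²` (`a, b ≤ n`). [folklore] -/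
theorem normSq_sub_sub_le {N : Fin d → ℕ} [∀ μ, NeZero (N μ)] (θ : Tor N → ℂ) (z : Tor N) (κ : Fin d)
    {a b : ℕ} (ha : a ≤ n) (hb : b ≤ n) :
    ‖θ (z + tstep N κ a) - θ (z + tstep N κ b)‖ ^ 2 ≤ 4 * n * ∑ i : Fin n, ‖fd κ θ (z + tstep N κ i)‖ ^ 2 := by
  set S := ∑ i : Fin n, ‖fd κ θ (z + tstep N κ i)‖ ^ 2 with hS
  have hS' : S = ∑ i ∈ Finset.range n, ‖fd κ θ (z + tstep N κ i)‖ ^ 2 := by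
    rw [hS, ← Finset.sum_range (fun i => ‖fd κ θ (z + tstep N κ i)‖ ^ 2)]
  have key : ∀ m : ℕ, m ≤ n → ‖θ (z + tstep N κ m) - θ z‖ ^ 2 ≤ n * S := by
    intro m hm
    refine (normSq_sub_tstep_le θ z κ m).trans ?_
    have h1 : ∑ i ∈ Finset.range m, ‖fd κ θ (z + tstep N κ i)‖ ^ 2 ≤ S := by
      rw [hS']
      exact Finset.sum_le_sum_of_subset_of_nonneg (Finset.range_subset_range.mpr hm) fun _ _ _ => sq_nonneg _
    have h2 : (m : ℝ) ≤ n := by exact_mod_cast hm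
    have h3 : 0 ≤ ∑ i ∈ Finset.range m, ‖fd κ θ (z + tstep N κ i)‖ ^ 2 := Finset.sum_nonneg fun _ _ => sq_nonneg _
    calc (m : ℝ) * ∑ i ∈ Finset.range m, ‖fd κ θ (z + tstep N κ i)‖ ^ 2 ≤ n * ∑ i ∈ Finset.range m, ‖fd κ θ (z + tstep N κ i)‖ ^ 2 :=
        mul_le_mul_of_nonneg_right h2 h3
      _ ≤ n * S := mul_le_mul_of_nonneg_left h1 (Nat.cast_nonneg n)
  have hsplit : ‖θ (z + tstep N κ a) - θ (z + tstep N κ b)‖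
      ≤ ‖θ (z + tstep N κ a) - θ z‖ + ‖θ (z + tstep N κ b) - θ z‖ := by
    rw [show θ (z + tstep N κ a) - θ (z + tstep N κ b) = (θ (z + tstep N κ a) - θ z) - (θ (z + tstep N κ b) - θ z) by ring]
    exact norm_sub_le _ _
  have ka := key a ha
  have kb := key b hb
  nlinarith [hsplit, ka, kb, norm_nonneg (θ (z + tstep N κ a) - θ (z + tstep N κ b)),
    norm_nonneg (θ (z + tstep N κ a) - θ z), norm_nonneg (θ (z + tstep N κ b) - θ z),
    sq_nonneg (‖θ (z + tstep N κ a) - θ z‖ - ‖θ (z + tstep N κ b) - θ z‖)]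

/-- Three intermediate points: `‖a − e‖² ≤ 3(‖a − b‖² + ‖b − c‖² + ‖c − e‖²)`. [folklore] -/
theorem normSq_sub_le_three (a b c e : ℂ) : ‖a - e‖ ^ 2 ≤ 3 * (‖a - b‖ ^ 2 + ‖b - c‖ ^ 2 + ‖c - e‖ ^ 2) := by
  have h : ‖a - e‖ ≤ ‖a - b‖ + ‖b - c‖ + ‖c - e‖ := by
    rw [show a - e = (a - b) + (b - c) + (c - e) by ring]
    exact norm_add₃_le
  have h2 : ‖a - e‖ ^ 2 ≤ (‖a - b‖ + ‖b - c‖ + ‖c - e‖) ^ 2 := pow_le_pow_left₀ (norm_nonneg _) h 2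
  nlinarith [h2, sq_nonneg (‖a - b‖ - ‖b - c‖), sq_nonneg (‖b - c‖ - ‖c - e‖), sq_nonneg (‖a - b‖ - ‖c - e‖)]

/-! ### §4.5 The digit path between two block offsets -/

/-- THE DIGIT PATH: `‖θ(n·y + j + v) − θ(n·y + j′ + v)‖² ≤ d Σ_κ 4n Σ_i ‖δ_κθ(n·y + ins κ i j′ j + v)‖²`
(telescoping over the `d` digits, each digit moved along a segment of length `< n`). [folklore] -/
theorem normSq_sub_digits_le (θ : Tor (fine n M) → ℂ) (y : Tor M) (j j' : Fin d → Fin n) (v : Tor (fine n M)) :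
    ‖θ (bpt n M y j + v) - θ (bpt n M y j' + v)‖ ^ 2
      ≤ d * ∑ κ : Fin d, (4 * n * ∑ i : Fin n, ‖fd κ θ (bpt n M y (ins n κ i j' j) + v)‖ ^ 2) := by
  set f : ℕ → ℂ := fun k => θ (bpt n M y (mrg n k j' j) + v) with hf
  have h0 : f 0 = θ (bpt n M y j' + v) := by simp [hf, mrg_zero]
  have hd : f d = θ (bpt n M y j + v) := by simp [hf, mrg_self]
  have htel : θ (bpt n M y j + v) - θ (bpt n M y j' + v) = ∑ k ∈ Finset.range d, (f (k + 1) - f k) := by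
    rw [Finset.sum_range_sub, hd, h0]
  -- each digit step is a move along a segment in direction κ = k
  have hstep : ∀ κ : Fin d, ‖f (κ.val + 1) - f κ.val‖ ^ 2
      ≤ 4 * n * ∑ i : Fin n, ‖fd κ θ (bpt n M y (ins n κ i j' j) + v)‖ ^ 2 := by
    intro κ
    have e1 : bpt n M y (mrg n (κ.val + 1) j' j)
        = bpt n M y (Function.update (mrg n κ.val j' j) κ 0) + tstep (fine n M) κ ((j κ : Fin n) : ℕ) := by
      rw [mrg_succ, bpt_update]
    have e2 : bpt n M y (mrg n κ.val j' j)
        = bpt n M y (Function.update (mrg n κ.val j' j) κ 0) + tstep (fine n M) κ ((j' κ : Fin n) : ℕ) := by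
      have h := bpt_update n M y (mrg n κ.val j' j) κ (j' κ)
      rwa [← mrg_eq_update] at h
    set z := bpt n M y (Function.update (mrg n κ.val j' j) κ 0) + v with hz
    have hf1 : f (κ.val + 1) = θ (z + tstep (fine n M) κ ((j κ : Fin n) : ℕ)) := by
      simp only [hf, e1, hz, add_right_comm]
    have hf0 : f κ.val = θ (z + tstep (fine n M) κ ((j' κ : Fin n) : ℕ)) := by
      simp only [hf, e2, hz, add_right_comm]
    have hsum : ∀ i : Fin n, z + tstep (fine n M) κ (i : ℕ) = bpt n M y (ins n κ i j' j) + v := by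
      intro i
      rw [hz, add_right_comm, ins, bpt_update n M y (mrg n κ.val j' j) κ i]
    rw [hf1, hf0]
    simp only [← hsum]
    exact normSq_sub_sub_le n θ z κ (j κ).isLt.le (j' κ).isLt.le
  rw [htel]
  calc ‖∑ k ∈ Finset.range d, (f (k + 1) - f k)‖ ^ 2
      ≤ (∑ k ∈ Finset.range d, ‖f (k + 1) - f k‖) ^ 2 := pow_le_pow_left₀ (norm_nonneg _) (norm_sum_le _ _) 2
    _ ≤ (Finset.range d).card * ∑ k ∈ Finset.range d, ‖f (k + 1) - f k‖ ^ 2 := sq_sum_le_card_mul_sum_sq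
    _ = d * ∑ κ : Fin d, ‖f (κ.val + 1) - f κ.val‖ ^ 2 := by
        rw [Finset.card_range, Finset.sum_range (fun k => ‖f (k + 1) - f k‖ ^ 2)]
    _ ≤ d * ∑ κ : Fin d, (4 * n * ∑ i : Fin n, ‖fd κ θ (bpt n M y (ins n κ i j' j) + v)‖ ^ 2) := by
        gcongr with κ _
        exact hstep κ

/-! ### §4.6 The three-leg path between two stencil points and its pointwise bound -/

/-- Leg 1 (the `ν`-offset): `4n Σ_i ‖δ_νθ(n·y + j′ + s′e_μ + i e_ν)‖²`. [folklore] -/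
def T1f (θ : Tor (fine n M) → ℂ) (μ ν : Fin d) (y : Tor M) (j' : Fin d → Fin n) (s' : Fin n) : ℝ :=
  4 * n * ∑ i : Fin n, ‖fd ν θ (bpt n M y j' + tstep (fine n M) μ s' + tstep (fine n M) ν i)‖ ^ 2

/-- Leg 2 (the `μ`-offset): `4n Σ_i ‖δ_μθ(n·y + j′ + t e_ν + i e_μ)‖²`. [folklore] -/
def T2f (θ : Tor (fine n M) → ℂ) (μ ν : Fin d) (y : Tor M) (j' : Fin d → Fin n) (t : Fin n) : ℝ :=
  4 * n * ∑ i : Fin n, ‖fd μ θ (bpt n M y j' + tstep (fine n M) ν t + tstep (fine n M) μ i)‖ ^ 2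

/-- Leg 3 (the block digits): `d Σ_κ 4n Σ_i ‖δ_κθ(n·y + ins κ i j′ j + s e_μ + t e_ν)‖²`. [folklore] -/
def T3f (θ : Tor (fine n M) → ℂ) (μ ν : Fin d) (y : Tor M) (j j' : Fin d → Fin n) (s t : Fin n) : ℝ :=
  d * ∑ κ : Fin d, (4 * n * ∑ i : Fin n,
    ‖fd κ θ (bpt n M y (ins n κ i j' j) + (tstep (fine n M) μ s + tstep (fine n M) ν t))‖ ^ 2)

/-- THE POINTWISE PATH BOUND between the stencil points `X_y(j′,s′,t′)` and `X_y(j,s,t)`: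
`‖θ(X′) − θ(X)‖² ≤ 3 (T1 + T2 + T3)`. [folklore] -/
theorem stencil_pointwise (θ : Tor (fine n M) → ℂ) (μ ν : Fin d) (y : Tor M) (j j' : Fin d → Fin n) (s t s' t' : Fin n) :
    ‖θ (spt n M μ ν y (j', s', t')) - θ (spt n M μ ν y (j, s, t))‖ ^ 2
      ≤ 3 * (T1f n M θ μ ν y j' s' + T2f n M θ μ ν y j' t + T3f n M θ μ ν y j j' s t) := by
  rw [spt_apply, spt_apply]
  -- the intermediate points
  set X' := bpt n M y j' + tstep (fine n M) μ s' + tstep (fine n M) ν t' with hX'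
  set Y1 := bpt n M y j' + tstep (fine n M) μ s' + tstep (fine n M) ν t with hY1
  set Y2 := bpt n M y j' + tstep (fine n M) μ s + tstep (fine n M) ν t with hY2
  set X := bpt n M y j + tstep (fine n M) μ s + tstep (fine n M) ν t with hX
  have h3 := normSq_sub_le_three (θ X') (θ Y1) (θ Y2) (θ X)
  have hT1 : ‖θ X' - θ Y1‖ ^ 2 ≤ T1f n M θ μ ν y j' s' :=
    normSq_sub_sub_le n θ (bpt n M y j' + tstep (fine n M) μ s') ν t'.isLt.le t.isLt.le
  have hT2 : ‖θ Y1 - θ Y2‖ ^ 2 ≤ T2f n M θ μ ν y j' t := by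
    have e1 : Y1 = bpt n M y j' + tstep (fine n M) ν t + tstep (fine n M) μ s' := add_right_comm _ _ _
    have e2 : Y2 = bpt n M y j' + tstep (fine n M) ν t + tstep (fine n M) μ s := add_right_comm _ _ _
    rw [e1, e2]
    exact normSq_sub_sub_le n θ (bpt n M y j' + tstep (fine n M) ν t) μ s'.isLt.le s.isLt.le
  have hT3 : ‖θ Y2 - θ X‖ ^ 2 ≤ T3f n M θ μ ν y j j' s t := by
    have e1 : Y2 = bpt n M y j' + (tstep (fine n M) μ s + tstep (fine n M) ν t) := add_assoc _ _ _
    have e2 : X = bpt n M y j + (tstep (fine n M) μ s + tstep (fine n M) ν t) := add_assoc _ _ _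
    rw [e1, e2, norm_sub_rev]
    exact normSq_sub_digits_le n M θ y j j' _
  linarith [h3, hT1, hT2, hT3]

/-! ### §4.7 Summing the legs exactly (block partition, translation invariance, fibre count) -/

/-- `Σ_y Σ_j Σ_{j′} T1 = 4 n^{d+2} E_ν(θ)`. [folklore] -/
theorem sum_T1f (θ : Tor (fine n M) → ℂ) (μ ν : Fin d) (s' : Fin n) :
    ∑ y : Tor M, ∑ _j : Fin d → Fin n, ∑ j' : Fin d → Fin n, T1f n M θ μ ν y j' s'
      = 4 * (n : ℝ) ^ (d + 2) * dE ν θ := by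
  have h := sum_sum_sum_bpt_add n M (fun x => ‖fd ν θ x‖ ^ 2)
    (fun i : Fin n => tstep (fine n M) μ s' + tstep (fine n M) ν (i : ℕ))
  simp only [← add_assoc] at h
  simp only [T1f, Finset.sum_const, Finset.card_univ, card_digits, nsmul_eq_mul, ← Finset.mul_sum]
  rw [h, dE]
  push_cast
  ring

/-- `Σ_y Σ_j Σ_{j′} T2 = 4 n^{d+2} E_μ(θ)`. [folklore] -/
theorem sum_T2f (θ : Tor (fine n M) → ℂ) (μ ν : Fin d) (t : Fin n) :
    ∑ y : Tor M, ∑ _j : Fin d → Fin n, ∑ j' : Fin d → Fin n, T2f n M θ μ ν y j' t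
      = 4 * (n : ℝ) ^ (d + 2) * dE μ θ := by
  have h := sum_sum_sum_bpt_add n M (fun x => ‖fd μ θ x‖ ^ 2)
    (fun i : Fin n => tstep (fine n M) ν t + tstep (fine n M) μ (i : ℕ))
  simp only [← add_assoc] at h
  simp only [T2f, Finset.sum_const, Finset.card_univ, card_digits, nsmul_eq_mul, ← Finset.mul_sum]
  rw [h, dE]
  push_cast
  ring

/-- `Σ_y Σ_j Σ_{j′} T3 = 4 d n^{d+2} Σ_κ E_κ(θ)` (the fibre count `sum_ins`). [folklore] -/
theorem sum_T3f (θ : Tor (fine n M) → ℂ) (μ ν : Fin d) (s t : Fin n) :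
    ∑ y : Tor M, ∑ j : Fin d → Fin n, ∑ j' : Fin d → Fin n, T3f n M θ μ ν y j j' s t
      = 4 * d * (n : ℝ) ^ (d + 2) * ∑ κ : Fin d, dE κ θ := by
  set v := tstep (fine n M) μ s + tstep (fine n M) ν t with hv
  -- per block: reorder, then the fibre count
  have hin : ∀ y : Tor M, ∑ j : Fin d → Fin n, ∑ j' : Fin d → Fin n, T3f n M θ μ ν y j j' s t
      = d * ∑ κ : Fin d, (4 * n * ((n : ℝ) ^ (d + 1) * ∑ w : Fin d → Fin n, ‖fd κ θ (bpt n M y w + v)‖ ^ 2)) := by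
    intro y
    have hre : ∀ H : (Fin d → Fin n) → (Fin d → Fin n) → Fin d → ℝ,
        ∑ j : Fin d → Fin n, ∑ j' : Fin d → Fin n, ∑ κ : Fin d, H j j' κ
          = ∑ κ : Fin d, ∑ j : Fin d → Fin n, ∑ j' : Fin d → Fin n, H j j' κ := by
      intro H
      calc ∑ j : Fin d → Fin n, ∑ j' : Fin d → Fin n, ∑ κ : Fin d, H j j' κ
          = ∑ j : Fin d → Fin n, ∑ κ : Fin d, ∑ j' : Fin d → Fin n, H j j' κ :=
            Finset.sum_congr rfl fun _ _ => Finset.sum_comm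
        _ = ∑ κ : Fin d, ∑ j : Fin d → Fin n, ∑ j' : Fin d → Fin n, H j j' κ := Finset.sum_comm
    have hfc : ∀ κ : Fin d, ∑ j : Fin d → Fin n, ∑ j' : Fin d → Fin n, ∑ i : Fin n,
        ‖fd κ θ (bpt n M y (ins n κ i j' j) + v)‖ ^ 2
          = (n : ℝ) ^ (d + 1) * ∑ w : Fin d → Fin n, ‖fd κ θ (bpt n M y w + v)‖ ^ 2 :=
      fun κ => sum_ins n κ (fun w => ‖fd κ θ (bpt n M y w + v)‖ ^ 2)
    simp only [T3f, ← hv]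
    simp only [Finset.mul_sum]
    rw [hre]
    refine Finset.sum_congr rfl fun κ _ => ?_
    simp only [← Finset.mul_sum]
    rw [hfc κ]
  simp_rw [hin]
  -- sum over blocks
  have hbl : ∀ κ : Fin d, ∑ y : Tor M, ∑ w : Fin d → Fin n, ‖fd κ θ (bpt n M y w + v)‖ ^ 2 = dE κ θ :=
    fun κ => sum_sum_bpt_add n M (fun x => ‖fd κ θ x‖ ^ 2) v
  simp only [Finset.mul_sum]
  rw [Finset.sum_comm]
  refine Finset.sum_congr rfl fun κ _ => ?_
  simp only [← Finset.mul_sum]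
  rw [hbl κ]
  ring

/-! ### §4.8 The stencil Poincaré inequality -/

/-- THE STENCIL POINCARÉ INEQUALITY: `W(θ) ≤ 12 n^{d+6} (E_μ(θ) + E_ν(θ) + d Σ_κ E_κ(θ))` — the pair-variance of a
plaquette function over the stencils of the block average is controlled, WITHOUT VOLUME LOSS, by one fine-lattice
difference of the function. [folklore] -/
theorem W_le (μ ν : Fin d) (θ : Tor (fine n M) → ℂ) :
    W n M μ ν θ ≤ 12 * (n : ℝ) ^ (d + 6) * (dE μ θ + dE ν θ + d * ∑ κ : Fin d, dE κ θ) := by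
  have hW : W n M μ ν θ = ∑ y : Tor M, ∑ P : Off d n, ∑ P' : Off d n, ‖θ (spt n M μ ν y P') - θ (spt n M μ ν y P)‖ ^ 2 := by
    simp only [W, pvar]
  rw [hW, sum_stencil_reindex n M (fun y P P' => ‖θ (spt n M μ ν y P') - θ (spt n M μ ν y P)‖ ^ 2)]
  calc ∑ s : Fin n, ∑ t : Fin n, ∑ s' : Fin n, ∑ t' : Fin n, ∑ y : Tor M, ∑ j : Fin d → Fin n, ∑ j' : Fin d → Fin n,
          ‖θ (spt n M μ ν y (j', s', t')) - θ (spt n M μ ν y (j, s, t))‖ ^ 2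
      ≤ ∑ s : Fin n, ∑ t : Fin n, ∑ s' : Fin n, ∑ t' : Fin n, ∑ y : Tor M, ∑ j : Fin d → Fin n, ∑ j' : Fin d → Fin n,
          3 * (T1f n M θ μ ν y j' s' + T2f n M θ μ ν y j' t + T3f n M θ μ ν y j j' s t) := by
        gcongr with s _ t _ s' _ t' _ y _ j _ j' _
        exact stencil_pointwise n M θ μ ν y j j' s t s' t'
    _ = ∑ s : Fin n, ∑ t : Fin n, ∑ s' : Fin n, ∑ t' : Fin n,
          3 * (4 * (n : ℝ) ^ (d + 2) * dE ν θ + 4 * (n : ℝ) ^ (d + 2) * dE μ θ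
            + 4 * d * (n : ℝ) ^ (d + 2) * ∑ κ : Fin d, dE κ θ) := by
        refine Finset.sum_congr rfl fun s _ => Finset.sum_congr rfl fun t _ =>
          Finset.sum_congr rfl fun s' _ => Finset.sum_congr rfl fun t' _ => ?_
        rw [← sum_T1f n M θ μ ν s', ← sum_T2f n M θ μ ν t, ← sum_T3f n M θ μ ν s t]
        simp only [mul_add, Finset.sum_add_distrib, Finset.mul_sum]
    _ = 12 * (n : ℝ) ^ (d + 6) * (dE μ θ + dE ν θ + d * ∑ κ : Fin d, dE κ θ) := by
        simp only [Finset.sum_const, Finset.card_univ, Fintype.card_fin, nsmul_eq_mul]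
        ring

/-- The same with the plane energies absorbed: `W(θ) ≤ 12 (d+2) n^{d+6} Σ_κ E_κ(θ)`. [folklore] -/
theorem W_le' (μ ν : Fin d) (θ : Tor (fine n M) → ℂ) :
    W n M μ ν θ ≤ 12 * (d + 2) * (n : ℝ) ^ (d + 6) * ∑ κ : Fin d, dE κ θ := by
  have hμ : dE μ θ ≤ ∑ κ : Fin d, dE κ θ :=
    Finset.single_le_sum (f := fun κ => dE κ θ) (fun κ _ => dE_nonneg κ θ) (Finset.mem_univ μ)
  have hν : dE ν θ ≤ ∑ κ : Fin d, dE κ θ :=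
    Finset.single_le_sum (f := fun κ => dE κ θ) (fun κ _ => dE_nonneg κ θ) (Finset.mem_univ ν)
  have hpos : 0 ≤ 12 * (n : ℝ) ^ (d + 6) := by positivity
  calc W n M μ ν θ ≤ 12 * (n : ℝ) ^ (d + 6) * (dE μ θ + dE ν θ + d * ∑ κ : Fin d, dE κ θ) := W_le n M μ ν θ
    _ ≤ 12 * (n : ℝ) ^ (d + 6) * ((∑ κ : Fin d, dE κ θ) + (∑ κ : Fin d, dE κ θ) + d * ∑ κ : Fin d, dE κ θ) := by
        gcongr
    _ = 12 * (d + 2) * (n : ℝ) ^ (d + 6) * ∑ κ : Fin d, dE κ θ := by ring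

end Poincare

/-! ## §5 THE MODEL FORM OF (β′) AND (β): the one-step abelian action deficit and its derivative are controlled by one
fine-lattice difference of the plaquette field; gauge invariance -/

section Beta

variable {d : ℕ} (n : ℕ) [NeZero n] (M : Fin d → ℕ) [hM : ∀ μ, NeZero (M μ)]

/-- (β′) AT MODEL LEVEL, sharp form: `|deficit A| ≤ 6 n⁴ (E_μ + E_ν + d Σ_κ E_κ)(plaq A μ ν)` — the action lost by one
linear block-averaging step is at most a dimension-dependent constant times `n⁴` times the DIFFERENCE ENERGY of the fine
plaquette field (`n` = block side; no volume factor; constant plaquette fields lose nothing). [folklore] -/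
theorem abs_deficit_le (A : Tor (fine n M) × Fin d → ℂ) (μ ν : Fin d) :
    |deficit n M A μ ν| ≤ 6 * (n : ℝ) ^ 4 * (dE μ (plaq (fine n M) A μ ν) + dE ν (plaq (fine n M) A μ ν)
      + d * ∑ κ : Fin d, dE κ (plaq (fine n M) A μ ν)) := by
  have hn : (0 : ℝ) < n := by exact_mod_cast Nat.pos_of_ne_zero (NeZero.ne n)
  have hW := W_le n M μ ν (plaq (fine n M) A μ ν)
  rw [W_plaq_eq] at hW
  refine le_of_mul_le_mul_left ?_ (by positivity : (0 : ℝ) < 2 * (n : ℝ) ^ (d + 2))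
  calc 2 * (n : ℝ) ^ (d + 2) * |deficit n M A μ ν|
      ≤ 12 * (n : ℝ) ^ (d + 6) * (dE μ (plaq (fine n M) A μ ν) + dE ν (plaq (fine n M) A μ ν)
          + d * ∑ κ : Fin d, dE κ (plaq (fine n M) A μ ν)) := hW
    _ = _ := by ring

/-- (β′) AT MODEL LEVEL: `|deficit A| ≤ 6 (d+2) n⁴ Σ_κ E_κ(plaq A μ ν)`. [folklore] -/
theorem abs_deficit_le' (A : Tor (fine n M) × Fin d → ℂ) (μ ν : Fin d) :
    |deficit n M A μ ν| ≤ 6 * (d + 2) * (n : ℝ) ^ 4 * ∑ κ : Fin d, dE κ (plaq (fine n M) A μ ν) := by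
  have hn : (0 : ℝ) < n := by exact_mod_cast Nat.pos_of_ne_zero (NeZero.ne n)
  have hW := W_le' n M μ ν (plaq (fine n M) A μ ν)
  rw [W_plaq_eq] at hW
  refine le_of_mul_le_mul_left ?_ (by positivity : (0 : ℝ) < 2 * (n : ℝ) ^ (d + 2))
  calc 2 * (n : ℝ) ^ (d + 2) * |deficit n M A μ ν|
      ≤ 12 * (d + 2) * (n : ℝ) ^ (d + 6) * ∑ κ : Fin d, dE κ (plaq (fine n M) A μ ν) := hW
    _ = _ := by ring

/-- (β) AT MODEL LEVEL: the derivative of the one-step abelian action deficit at `A` in the direction `ψ` obeys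
`|B(A,ψ)| ≤ (6 (d+2) n⁴ Σ_κ E_κ(plaq A))^{1/2} · n (Σ_x ‖plaq ψ‖²)^{1/2}` — RATE = one fine-lattice difference of the
plaquette field of `A`, NORM = the fine curl-energy of `ψ`. [folklore] -/
theorem abs_bil_le_dE (A ψ : Tor (fine n M) × Fin d → ℂ) (μ ν : Fin d) :
    |bil n M A ψ μ ν| ≤ Real.sqrt (6 * (d + 2) * (n : ℝ) ^ 4 * ∑ κ : Fin d, dE κ (plaq (fine n M) A μ ν))
      * ((n : ℝ) * Real.sqrt (∑ x : Tor (fine n M), ‖plaq (fine n M) ψ μ ν x‖ ^ 2)) := by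
  refine (abs_bil_le_energy n M A ψ μ ν).trans (mul_le_mul_of_nonneg_right ?_ (by positivity))
  exact Real.sqrt_le_sqrt (abs_deficit_le' n M A μ ν)

/-- (β′) ∧ (β) AT MODEL LEVEL in one statement (value and derivative of the one-step abelian deficit, both with the rate
«one fine difference of the plaquette field»). [folklore] -/
theorem beta_model (A ψ : Tor (fine n M) × Fin d → ℂ) (μ ν : Fin d) :
    |deficit n M A μ ν| ≤ 6 * (d + 2) * (n : ℝ) ^ 4 * ∑ κ : Fin d, dE κ (plaq (fine n M) A μ ν)
    ∧ |bil n M A ψ μ ν| ≤ Real.sqrt (6 * (d + 2) * (n : ℝ) ^ 4 * ∑ κ : Fin d, dE κ (plaq (fine n M) A μ ν))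
        * ((n : ℝ) * Real.sqrt (∑ x : Tor (fine n M), ‖plaq (fine n M) ψ μ ν x‖ ^ 2)) :=
  ⟨abs_deficit_le' n M A μ ν, abs_bil_le_dE n M A ψ μ ν⟩

/-- The fine plaquette variable is gauge invariant (B5 (1.4): `F(A^λ) = F(A)`, tree `B5Action121.Fs_gaugeT`).
[cite: Balaban1984PropagatorsI, (1.4) p.18] -/
theorem plaq_gaugeT (A : Tor (fine n M) × Fin d → ℂ) (l : Tor (fine n M) → ℂ) (μ ν : Fin d) (x : Tor (fine n M)) :
    plaq (fine n M) (gaugeT (fine n M) (n : ℂ) A l) μ ν x = plaq (fine n M) A μ ν x := by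
  have h := Fs_gaugeT (fine n M) (n : ℂ) A l μ ν x
  rw [Fs_eq_mul_plaq, Fs_eq_mul_plaq] at h
  exact mul_left_cancel₀ (by exact_mod_cast NeZero.ne n) h

/-- The coarse plaquette variable of the average is gauge invariant (B5 (1.20)–(1.21): `Q_kA^λ = Q_kA − ∂Q′_kλ`, tree
`B5Block118.QvOp_gaugeT_eq`, and `F(B − ∂λ′) = F(B)`). [cite: Balaban1984PropagatorsI, (1.20) p. 20, (1.21) p. 21] -/
theorem plaq_QvOp_gaugeT (A : Tor (fine n M) × Fin d → ℂ) (l : Tor (fine n M) → ℂ) (μ ν : Fin d) (y : Tor M) :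
    plaq M (QvOp n M *ᵥ gaugeT (fine n M) (n : ℂ) A l) μ ν y = plaq M (QvOp n M *ᵥ A) μ ν y := by
  rw [QvOp_gaugeT_eq]
  have h := Fs_gaugeT M 1 (QvOp n M *ᵥ A) (QsOp n M *ᵥ l) μ ν y
  rw [Fs_eq_mul_plaq, Fs_eq_mul_plaq, one_mul, one_mul, gaugeT] at h
  exact h

/-- THE DEFICIT IS GAUGE INVARIANT: `deficit(A^λ) = deficit(A)` (so in the cell's dictionary only the gauge-invariant part
of a perturbation — its plaquette field — enters (β); the «coarse gradient legs» of B7 (14)/(48) drop out at model level).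
[cite: Balaban1984PropagatorsI, (1.4) p. 18, (1.20) p. 20, (1.21) p. 21] -/
theorem deficit_gaugeT (A : Tor (fine n M) × Fin d → ℂ) (l : Tor (fine n M) → ℂ) (μ ν : Fin d) :
    deficit n M (gaugeT (fine n M) (n : ℂ) A l) μ ν = deficit n M A μ ν := by
  simp only [deficit, plaq_gaugeT, plaq_QvOp_gaugeT]

/-- … and so is its polar form in the first argument. [folklore] -/
theorem bil_gaugeT (A ψ : Tor (fine n M) × Fin d → ℂ) (l : Tor (fine n M) → ℂ) (μ ν : Fin d) :
    bil n M (gaugeT (fine n M) (n : ℂ) A l) ψ μ ν = bil n M A ψ μ ν := by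
  simp only [bil, plaq_gaugeT, plaq_QvOp_gaugeT]

end Beta

/-! ## §6 LOCALITY of the derivative bound (v1.1, append-only): the polar form is a sum of STENCIL DENSITIES, each
controlled by the LOCAL three-leg energy of the plaquette field around its block; only the blocks on which the
direction's plaquette field is not stencil-constant contribute — the local form of (β) that the localisation step δ
consumes (record §5.3, Appendix β §6 «the bound is LOCAL») -/

section Locality

variable {d : ℕ} (n : ℕ) [NeZero n] (M : Fin d → ℕ) [hM : ∀ μ, NeZero (M μ)]

/-- The stencil pair variance of `θ` AT the coarse plaquette `y`: `V_y(θ) = Σ_P Σ_{P′} ‖θ(X_yP′) − θ(X_yP)‖²`, so that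
`W(θ) = Σ_y V_y(θ)`. [folklore] -/
def pvarAt (μ ν : Fin d) (θ : Tor (fine n M) → ℂ) (y : Tor M) : ℝ :=
  pvar (fun P : Off d n => θ (spt n M μ ν y P))

omit [NeZero n] in
/-- `W = Σ_y V_y`. [folklore] -/
theorem W_eq_sum_pvarAt (μ ν : Fin d) (θ : Tor (fine n M) → ℂ) :
    W n M μ ν θ = ∑ y : Tor M, pvarAt n M μ ν θ y := rfl

omit [NeZero n] hM in
/-- `0 ≤ V_y(θ)`. [folklore] -/
theorem pvarAt_nonneg (μ ν : Fin d) (θ : Tor (fine n M) → ℂ) (y : Tor M) : 0 ≤ pvarAt n M μ ν θ y :=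
  pvar_nonneg _

omit [NeZero n] hM in
/-- A field constant on the stencil of `y` has `V_y = 0` (in particular a direction whose plaquette field VANISHES on the
stencil of `y` does not see `y`). [folklore] -/
theorem pvarAt_eq_zero_of_const (μ ν : Fin d) (θ : Tor (fine n M) → ℂ) (y : Tor M) (c : ℂ)
    (h : ∀ P : Off d n, θ (spt n M μ ν y P) = c) : pvarAt n M μ ν θ y = 0 := by
  simp [pvarAt, pvar, h]

/-- The STENCIL DENSITY of the polar form at `y`:
`b_y(A, ψ) = Re⟨Σ_P θ_A(X_yP), Σ_P θ_ψ(X_yP)⟩ − n^{d+2} Σ_P Re⟨θ_A(X_yP), θ_ψ(X_yP)⟩`. [folklore] -/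
def bilAt (A ψ : Tor (fine n M) × Fin d → ℂ) (μ ν : Fin d) (y : Tor M) : ℝ :=
  rin (∑ P : Off d n, plaq (fine n M) A μ ν (spt n M μ ν y P)) (∑ P : Off d n, plaq (fine n M) ψ μ ν (spt n M μ ν y P))
    - Fintype.card (Off d n) * ∑ P : Off d n,
        rin (plaq (fine n M) A μ ν (spt n M μ ν y P)) (plaq (fine n M) ψ μ ν (spt n M μ ν y P))

/-- `B(A, ψ) = n^{-(d+2)} Σ_y b_y(A, ψ)` (= `bil_eq`). [folklore] -/
theorem bil_eq_sum_bilAt (A ψ : Tor (fine n M) × Fin d → ℂ) (μ ν : Fin d) :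
    bil n M A ψ μ ν = 1 / (n : ℝ) ^ (d + 2) * ∑ y : Tor M, bilAt n M A ψ μ ν y :=
  bil_eq n M A ψ μ ν

omit [NeZero n] hM in
/-- Cauchy–Schwarz PER STENCIL: `|b_y(A, ψ)| ≤ ½ V_y(θ_A)^{1/2} V_y(θ_ψ)^{1/2}`. [folklore] -/
theorem abs_bilAt_le (A ψ : Tor (fine n M) × Fin d → ℂ) (μ ν : Fin d) (y : Tor M) :
    |bilAt n M A ψ μ ν y| ≤ (1 / 2) * Real.sqrt (pvarAt n M μ ν (plaq (fine n M) A μ ν) y)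
      * Real.sqrt (pvarAt n M μ ν (plaq (fine n M) ψ μ ν) y) :=
  abs_rin_sum_sum_sub_le _ _

omit [NeZero n] hM in
/-- A stencil on which the direction's plaquette field has zero pair variance contributes nothing. [folklore] -/
theorem bilAt_eq_zero_of_pvarAt_eq_zero (A ψ : Tor (fine n M) × Fin d → ℂ) (μ ν : Fin d) (y : Tor M)
    (h : pvarAt n M μ ν (plaq (fine n M) ψ μ ν) y = 0) : bilAt n M A ψ μ ν y = 0 := by
  have := abs_bilAt_le n M A ψ μ ν y
  rw [h, Real.sqrt_zero, mul_zero] at this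
  exact abs_eq_zero.mp (le_antisymm this (abs_nonneg _))

/-- LOCAL CAUCHY–SCHWARZ FOR THE POLAR FORM.  For every coarse region `Y` off which the plaquette field of the direction `ψ`
is stencil-constant (`V_y(θ_ψ) = 0` for `y ∉ Y`):
`|B(A, ψ)| ≤ ½ n^{-(d+2)} (Σ_{y∈Y} V_y(θ_A))^{1/2} · W(θ_ψ)^{1/2}` — only the stencil variances of `A` ON `Y` enter. [folklore] -/
theorem abs_bil_le_local (A ψ : Tor (fine n M) × Fin d → ℂ) (μ ν : Fin d) (Y : Finset (Tor M))
    (hY : ∀ y, y ∉ Y → pvarAt n M μ ν (plaq (fine n M) ψ μ ν) y = 0) :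
    |bil n M A ψ μ ν| ≤ (1 / 2) * (1 / (n : ℝ) ^ (d + 2))
      * Real.sqrt (∑ y ∈ Y, pvarAt n M μ ν (plaq (fine n M) A μ ν) y)
      * Real.sqrt (W n M μ ν (plaq (fine n M) ψ μ ν)) := by
  have hn : (0 : ℝ) < n := by exact_mod_cast Nat.pos_of_ne_zero (NeZero.ne n)
  set θ := plaq (fine n M) A μ ν with hθ
  set φ := plaq (fine n M) ψ μ ν with hφ
  -- restrict the sum of densities to Y
  have hrestrict : ∑ y : Tor M, bilAt n M A ψ μ ν y = ∑ y ∈ Y, bilAt n M A ψ μ ν y := by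
    symm
    refine Finset.sum_subset (Finset.subset_univ Y) ?_
    intro y _ hy
    exact bilAt_eq_zero_of_pvarAt_eq_zero n M A ψ μ ν y (hY y hy)
  rw [bil_eq_sum_bilAt, hrestrict, abs_mul, abs_of_pos (by positivity : (0 : ℝ) < 1 / (n : ℝ) ^ (d + 2))]
  have hcs : |∑ y ∈ Y, bilAt n M A ψ μ ν y|
      ≤ (1 / 2) * Real.sqrt (∑ y ∈ Y, pvarAt n M μ ν θ y) * Real.sqrt (∑ y ∈ Y, pvarAt n M μ ν φ y) := by
    calc |∑ y ∈ Y, bilAt n M A ψ μ ν y|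
        ≤ ∑ y ∈ Y, |bilAt n M A ψ μ ν y| := Finset.abs_sum_le_sum_abs _ _
      _ ≤ ∑ y ∈ Y, (1 / 2) * (Real.sqrt (pvarAt n M μ ν θ y) * Real.sqrt (pvarAt n M μ ν φ y)) := by
          refine Finset.sum_le_sum fun y _ => ?_
          have := abs_bilAt_le n M A ψ μ ν y
          rw [← hθ, ← hφ] at this
          linarith
      _ = (1 / 2) * ∑ y ∈ Y, Real.sqrt (pvarAt n M μ ν θ y) * Real.sqrt (pvarAt n M μ ν φ y) := by
          rw [Finset.mul_sum]
      _ ≤ (1 / 2) * (Real.sqrt (∑ y ∈ Y, Real.sqrt (pvarAt n M μ ν θ y) ^ 2)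
            * Real.sqrt (∑ y ∈ Y, Real.sqrt (pvarAt n M μ ν φ y) ^ 2)) := by
          gcongr
          exact Real.sum_mul_le_sqrt_mul_sqrt _ _ _
      _ = (1 / 2) * Real.sqrt (∑ y ∈ Y, pvarAt n M μ ν θ y) * Real.sqrt (∑ y ∈ Y, pvarAt n M μ ν φ y) := by
          rw [Finset.sum_congr rfl fun y _ => Real.sq_sqrt (pvarAt_nonneg n M μ ν θ y),
            Finset.sum_congr rfl fun y _ => Real.sq_sqrt (pvarAt_nonneg n M μ ν φ y), mul_assoc]
  have hWφ : ∑ y ∈ Y, pvarAt n M μ ν φ y ≤ W n M μ ν φ := by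
    rw [W_eq_sum_pvarAt]
    exact Finset.sum_le_univ_sum_of_nonneg fun y => pvarAt_nonneg n M μ ν φ y
  have hsq : Real.sqrt (∑ y ∈ Y, pvarAt n M μ ν φ y) ≤ Real.sqrt (W n M μ ν φ) := Real.sqrt_le_sqrt hWφ
  calc 1 / (n : ℝ) ^ (d + 2) * |∑ y ∈ Y, bilAt n M A ψ μ ν y|
      ≤ 1 / (n : ℝ) ^ (d + 2) * ((1 / 2) * Real.sqrt (∑ y ∈ Y, pvarAt n M μ ν θ y)
          * Real.sqrt (∑ y ∈ Y, pvarAt n M μ ν φ y)) := by gcongr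
    _ ≤ 1 / (n : ℝ) ^ (d + 2) * ((1 / 2) * Real.sqrt (∑ y ∈ Y, pvarAt n M μ ν θ y)
          * Real.sqrt (W n M μ ν φ)) := by gcongr
    _ = _ := by ring

/-- The LOCAL THREE-LEG ENERGY of `θ` at the coarse plaquette `y`: the sum over pairs of stencil points of the path
bounds of `stencil_pointwise` — a sum of `‖δ_κθ‖²` over fine points within two blocks of `n·y` (legs along `e_ν`, `e_μ`
and the block digits), with explicit multiplicities. [folklore] -/
def Eloc (μ ν : Fin d) (θ : Tor (fine n M) → ℂ) (y : Tor M) : ℝ :=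
  ∑ P : Off d n, ∑ P' : Off d n,
    3 * (T1f n M θ μ ν y P'.1 P'.2.1 + T2f n M θ μ ν y P'.1 P.2.2 + T3f n M θ μ ν y P.1 P'.1 P.2.1 P.2.2)

/-- LOCAL STENCIL POINCARÉ: `V_y(θ) ≤ E^{loc}_y(θ)`. [folklore] -/
theorem pvarAt_le_Eloc (μ ν : Fin d) (θ : Tor (fine n M) → ℂ) (y : Tor M) :
    pvarAt n M μ ν θ y ≤ Eloc n M μ ν θ y := by
  unfold pvarAt pvar Eloc
  refine Finset.sum_le_sum fun P _ => Finset.sum_le_sum fun P' _ => ?_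
  obtain ⟨j, s, t⟩ := P
  obtain ⟨j', s', t'⟩ := P'
  exact stencil_pointwise n M θ μ ν y j j' s t s' t'

omit [NeZero n] hM in
/-- `0 ≤ E^{loc}_y(θ)`. [folklore] -/
theorem Eloc_nonneg (μ ν : Fin d) (θ : Tor (fine n M) → ℂ) (y : Tor M) : 0 ≤ Eloc n M μ ν θ y := by
  unfold Eloc T1f T2f T3f
  positivity

/-- GLOBAL CONSISTENCY of the local energies: `Σ_y E^{loc}_y(θ) = 12 n^{d+6} (E_μ + E_ν + d Σ_κ E_κ)(θ)` EXACTLY (the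
fibre count of `W_le`). [folklore] -/
theorem sum_Eloc_eq (μ ν : Fin d) (θ : Tor (fine n M) → ℂ) :
    ∑ y : Tor M, Eloc n M μ ν θ y = 12 * (n : ℝ) ^ (d + 6) * (dE μ θ + dE ν θ + d * ∑ κ : Fin d, dE κ θ) := by
  unfold Eloc
  rw [sum_stencil_reindex n M (fun y P P' =>
    3 * (T1f n M θ μ ν y P'.1 P'.2.1 + T2f n M θ μ ν y P'.1 P.2.2 + T3f n M θ μ ν y P.1 P'.1 P.2.1 P.2.2))]
  calc ∑ s : Fin n, ∑ t : Fin n, ∑ s' : Fin n, ∑ t' : Fin n, ∑ y : Tor M, ∑ j : Fin d → Fin n, ∑ j' : Fin d → Fin n,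
          3 * (T1f n M θ μ ν y j' s' + T2f n M θ μ ν y j' t + T3f n M θ μ ν y j j' s t)
      = ∑ s : Fin n, ∑ t : Fin n, ∑ s' : Fin n, ∑ t' : Fin n,
          3 * (4 * (n : ℝ) ^ (d + 2) * dE ν θ + 4 * (n : ℝ) ^ (d + 2) * dE μ θ
            + 4 * d * (n : ℝ) ^ (d + 2) * ∑ κ : Fin d, dE κ θ) := by
        refine Finset.sum_congr rfl fun s _ => Finset.sum_congr rfl fun t _ =>
          Finset.sum_congr rfl fun s' _ => Finset.sum_congr rfl fun t' _ => ?_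
        rw [← sum_T1f n M θ μ ν s', ← sum_T2f n M θ μ ν t, ← sum_T3f n M θ μ ν s t]
        simp only [mul_add, Finset.sum_add_distrib, Finset.mul_sum]
    _ = 12 * (n : ℝ) ^ (d + 6) * (dE μ θ + dE ν θ + d * ∑ κ : Fin d, dE κ θ) := by
        simp only [Finset.sum_const, Finset.card_univ, Fintype.card_fin, nsmul_eq_mul]
        ring

/-- Hence `Σ_{y∈Y} E^{loc}_y(θ) ≤ 12 (d+2) n^{d+6} Σ_κ E_κ(θ)` for every region `Y` (the local bound is never worse than
the global one). [folklore] -/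
theorem sum_Eloc_le (μ ν : Fin d) (θ : Tor (fine n M) → ℂ) (Y : Finset (Tor M)) :
    ∑ y ∈ Y, Eloc n M μ ν θ y ≤ 12 * (d + 2) * (n : ℝ) ^ (d + 6) * ∑ κ : Fin d, dE κ θ := by
  have h1 : ∑ y ∈ Y, Eloc n M μ ν θ y ≤ ∑ y : Tor M, Eloc n M μ ν θ y :=
    Finset.sum_le_univ_sum_of_nonneg fun y => Eloc_nonneg n M μ ν θ y
  rw [sum_Eloc_eq] at h1
  have hμ : dE μ θ ≤ ∑ κ : Fin d, dE κ θ :=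
    Finset.single_le_sum (f := fun κ => dE κ θ) (fun κ _ => dE_nonneg κ θ) (Finset.mem_univ μ)
  have hν : dE ν θ ≤ ∑ κ : Fin d, dE κ θ :=
    Finset.single_le_sum (f := fun κ => dE κ θ) (fun κ _ => dE_nonneg κ θ) (Finset.mem_univ ν)
  have hpos : 0 ≤ 12 * (n : ℝ) ^ (d + 6) := by positivity
  calc ∑ y ∈ Y, Eloc n M μ ν θ y
      ≤ 12 * (n : ℝ) ^ (d + 6) * (dE μ θ + dE ν θ + d * ∑ κ : Fin d, dE κ θ) := h1
    _ ≤ 12 * (n : ℝ) ^ (d + 6) * ((∑ κ : Fin d, dE κ θ) + (∑ κ : Fin d, dE κ θ) + d * ∑ κ : Fin d, dE κ θ) := by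
        gcongr
    _ = 12 * (d + 2) * (n : ℝ) ^ (d + 6) * ∑ κ : Fin d, dE κ θ := by ring

/-- (β) AT MODEL LEVEL, LOCAL FORM.  For every coarse region `Y` off which the plaquette field of `ψ` is stencil-constant:
`|B(A, ψ)| ≤ ½ n^{-(d+2)} (Σ_{y∈Y} E^{loc}_y(plaq A))^{1/2} · (2 n^{d+4} Σ_x ‖plaq ψ(x)‖²)^{1/2}` — the derivative of the
one-step deficit in the direction `ψ` sees the difference energy of the plaquette field of `A` ONLY AROUND THE BLOCKS WHERE
`ψ` ACTS (finite range: the three-leg regions of the stencils in `Y`), times the fine energy of `ψ`.  With `Y = everything`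
and `sum_Eloc_eq` this is `abs_bil_le_dE` again. [folklore] -/
theorem abs_bil_le_local_energy (A ψ : Tor (fine n M) × Fin d → ℂ) (μ ν : Fin d) (Y : Finset (Tor M))
    (hY : ∀ y, y ∉ Y → pvarAt n M μ ν (plaq (fine n M) ψ μ ν) y = 0) :
    |bil n M A ψ μ ν| ≤ (1 / 2) * (1 / (n : ℝ) ^ (d + 2))
      * Real.sqrt (∑ y ∈ Y, Eloc n M μ ν (plaq (fine n M) A μ ν) y)
      * Real.sqrt (2 * (n : ℝ) ^ (d + 4) * ∑ x : Tor (fine n M), ‖plaq (fine n M) ψ μ ν x‖ ^ 2) := by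
  have hn : (0 : ℝ) < n := by exact_mod_cast Nat.pos_of_ne_zero (NeZero.ne n)
  have h := abs_bil_le_local n M A ψ μ ν Y hY
  have hE : Real.sqrt (∑ y ∈ Y, pvarAt n M μ ν (plaq (fine n M) A μ ν) y)
      ≤ Real.sqrt (∑ y ∈ Y, Eloc n M μ ν (plaq (fine n M) A μ ν) y) :=
    Real.sqrt_le_sqrt (Finset.sum_le_sum fun y _ => pvarAt_le_Eloc n M μ ν _ y)
  have hWψ : Real.sqrt (W n M μ ν (plaq (fine n M) ψ μ ν))
      ≤ Real.sqrt (2 * (n : ℝ) ^ (d + 4) * ∑ x : Tor (fine n M), ‖plaq (fine n M) ψ μ ν x‖ ^ 2) := by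
    apply Real.sqrt_le_sqrt
    rw [W_plaq_eq]
    calc 2 * (n : ℝ) ^ (d + 2) * |deficit n M ψ μ ν|
        ≤ 2 * (n : ℝ) ^ (d + 2) * ((n : ℝ) ^ 2 * ∑ x : Tor (fine n M), ‖plaq (fine n M) ψ μ ν x‖ ^ 2) := by
          gcongr
          exact abs_deficit_le_fine n M ψ μ ν
      _ = _ := by ring
  have h0 : 0 ≤ (1 / 2) * (1 / (n : ℝ) ^ (d + 2)) := by positivity
  calc |bil n M A ψ μ ν|
      ≤ (1 / 2) * (1 / (n : ℝ) ^ (d + 2)) * Real.sqrt (∑ y ∈ Y, pvarAt n M μ ν (plaq (fine n M) A μ ν) y)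
          * Real.sqrt (W n M μ ν (plaq (fine n M) ψ μ ν)) := h
    _ ≤ (1 / 2) * (1 / (n : ℝ) ^ (d + 2)) * Real.sqrt (∑ y ∈ Y, Eloc n M μ ν (plaq (fine n M) A μ ν) y)
          * Real.sqrt (2 * (n : ℝ) ^ (d + 4) * ∑ x : Tor (fine n M), ‖plaq (fine n M) ψ μ ν x‖ ^ 2) := by
        gcongr

end Locality

end

end Literature.MathematicalPhysics.QuantumFieldTheory.Balaban1983to89.T4AveragingDeficit
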